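import Literature.AlgebraicGeometry.Motives.HodgeThetaAnnihilatorTimesRigidSymplectic
import Literature.AlgebraicGeometry.Motives.HodgeLieSymplecticBlocksRankFour
import Literature.AlgebraicGeometry.Motives.HodgeThetaSubalgebraSymplecticRankTenSkew
import Literature.AlgebraicGeometry.Motives.HodgeLieRigid
import HarnessLib

/-!
# Rational tensors on `V₁ ⊕ V₂` killed by `Θ` are killed by `0 ⊕ hg(V₂)` and by `Θ₁ ⊕ 0` when `hg(V₂)_ℂ = ⊕_σ 𝔰𝔭(V_σ)` is the FULL block-symplectic algebra of the real eigenblocks of the Hodge endomorphisms and there is no non-zero morphism of Hodge structures `V₂ → V₁` (Moonen–Zarhin 1999 Lemma (3.4) with (3.3) for a rigid `Res_{F/ℚ}`-symplectic factor of any rank: `Hg(X₁ × X₂) = Hg(X₁) × Hg(X₂)` or `Hom(X₂, X₁) ≠ 0` — the Lie step; Hazama 1989 / Moonen–Zarhin Thm. (3.2)(1))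

HONEST FRAMING (programme `pub-hodge-ring2`, verbatim): «research route conditional on HC_CM; not a corollary;
Q11.4-sentence-2 already refuted in dim ≥ 3». For THIS file: it is a step (R55) of the research route towards products
with a stably nondegenerate factor carrying real multiplication; its content is UNCONDITIONAL linear algebra (theorems
only, no new named fact, nothing here depends on `HC_CM`), it is not a corollary of the Hodge conjecture for any summit
statement, and it does not touch the refuted sentence 2 of Q11.4.

WHAT IS PRINTED. Moonen–Zarhin, §3 (3.1): for `X = X₁ × X₂`, `hg(X₁) ≅ 𝔤₁ ⊕ 𝔤₃`, `hg(X₂) ≅ 𝔤₂ ⊕ 𝔤₃` and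
`hg(X₁ × X₂) = 𝔤₁ ⊕ 𝔤₂ ⊕ Γ_φ` with `Γ_φ` the graph of an automorphism of `𝔤₃`; Thm. (3.2)(1) (Hazama): «Let `X₁` and
`X₂` be complex abelian varieties which both satisfy condition (D). Suppose `X₁` and `X₂` contain no factors of Type 4.
Then `X₁ × X₂` again satisfies (D), and either `Hom(X₁, X₂) ≠ 0` or `Hg(X₁ × X₂) = Hg(X₁) × Hg(X₂)`»; Lemma (3.4):
«Let `X₁` and `X₂` be nonzero complex abelian varieties. Write `X = X₁ × X₂`. Assume that `hg(X₂)` is a `ℚ`-simple Lie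
algebra of non-compact type and that, up to isomorphism, `V_{X₂}` is the only irreducible `hg(X₂)`-module which is a
length 1 representation of non-compact type. Then either `Hg(X) = Hg(X₁) × Hg(X₂)` or `Hom(X₂, X₁) ≠ 0`»; and the
eigenvalue bookkeeping of Lemma (3.3): «If `λ` is an eigenvalue of `J₂` on `U_j^{dq}` then we find that both `i + λ` and
`-i + λ` occur as eigenvalues of `J_Y` … this is possible only if `λ = 0`».

WHAT IS PROVED HERE (the tree's `HodgeThetaAnnihilatorTimesRigidSymplectic`, which is the case of ONE block
`hg(X₂) ⊗ ℂ = 𝔰𝔭(V₂ ⊗ ℂ)`, generalized to SEVERAL blocks). The second factor `V₂` carries an effective polarized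
weight-one Hodge structure `H₂` such that every Hodge endomorphism is `ψ₂`-self-adjoint, `V₂ ⊗ ℂ = ⊕ᵢ Tᵢ` is the
internal direct sum of the eigenblocks `Tᵢ = H₂.eigenBlock τᵢ` of a finite family of characters `τᵢ` of `End_Hdg(V₂)`
(the blocks are then pairwise `ψ₂ ⊗ ℂ`-orthogonal and `ψ₂ ⊗ ℂ` is nondegenerate alternating on each), and
(RIGID BLOCKS) every block-preserving `ψ₂ ⊗ ℂ`-skew operator of `V₂ ⊗ ℂ` lies in `Lie Hg(H₂) ⊗ ℂ` — so that
`Lie Hg(H₂) ⊗ ℂ = ⊕ᵢ 𝔰𝔭(Tᵢ, ψ₂)` (for an abelian variety with `End⁰ = F` a totally real field this is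
`Hg = Res_{F/ℚ} Sp_{2m,F}`, Milne's Prop. 4.8 (a) ⇒ (c) for condition (D); the blocks are Hazama's `V_i` of the real
places [cite: Hazama1983, §3 (pp. 305–306)]). Under `Hom_Hdg(V₂, V₁) = 0`:

* §0 `SymplecticWitness.eq_zero_of_theta_bracket_of_bracket`: a linear map on `End(M)` killing all `[T, Y]` (`Y`
  `ω`-skew, `T` an `ω`-skew involution) and closed under brackets of killed skew elements kills `𝔰𝔭(M, ω)` (the Levi is
  spanned by the `ω(p,q) Y_{p,q} = [R_p, R_q]`, `R_a = ±½[T, R_a]`; `levi_eq_neg_sum_pairOp`);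
  `SymplecticWitness.P_ne_bot_of_nontrivial`: `P ≠ 0` on a non-zero block.
* §1 `Blocks.exists_proj`: the block projections `p_k : V₂ ⊗ ℂ → T_k` of an internal direct sum, with their algebra.
* §2 `goursat_incl₂_mem_of_hom_eq_zero_of_rigidBlocks` — THE GOURSAT STEP: for a bracket-closed `𝔞 ⊆ End_ℚ(U)` of
  block-diagonal operators (w.r.t. `U = ι₁V₁ ⊕ ι₂V₂`) with `ψ₁`-skew first corners and `Θ_U ∈ 𝔞_ℂ` inducing `Θ₁`, `Θ₂`:
  `ι₂ Z π₂ ∈ 𝔞` for every `Z ∈ Lie Hg(H₂)`. Proof = Hazama's Goursat argument as in Moonen–Zarhin (3.1)–(3.4), block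
  by block: `c₂(𝔞) ⊇ 𝔥 = Lie Hg(H₂)` (Deligne's minimality, `hodgeLie_rigid`); a complement `𝔤₃` of the ideal
  `c₁(𝔞 ∩ ker c₂)` (`exists_ideal_compl`, reductivity); `ρ = c₁ ∘ c₂⁻¹ : 𝔥_ℂ → End(V₁ ⊗ ℂ)` is a bracket- and
  `ad Θ`-compatible map; on each simple block `𝔰𝔭(T_k)` it is injective or zero (`SymplecticIdeal.theta_mem_of_ne_bot`
  and §0); if injective, the standard representation occurs (`SymplecticWitness.exists_equivariant_ne_zero`), the other
  blocks act trivially on the witness (§0: their root vectors shift the `Θ`-weight by `2` — Lemma (3.3)'s eigenvalue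
  count), descent of commutants (`mem_span_baseChange_of_forall_commute`) produces a RATIONAL `ρ`-equivariant corner,
  which intertwines `Θ₂|_{T_k}` and `Θ₁` (`SymplecticWitness.theta_comp_eq_of_equivariant`) and vanishes by (HOM) —
  contradiction. So `ρ = 0`, `c₁` kills `c₂⁻¹(𝔥)`, and `𝔥 ⊆ {Z : ι₂ Z π₂ ∈ 𝔞}`.
* §3 the word model (annihilator algebra `annLie φ eQ aF q` of a rational coefficient tensor `q` killed by the matrix
  of `Θ_U`, `aF` = `End_Hdg(V₁)` placed on `V₁` and the two projectors): `incl₂_mem_annLie_of_times_rigidBlocks`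
  (`0 ⊕ hg(V₂) ⊆ 𝔞(q)` and `Θ_U ∈ 𝔞(q)_ℂ`), `incl₂_comp_proj_mem_spanC_annLie_of_times_rigidBlocks`
  (`0 ⊕ hg(V₂)_ℂ ⊆ 𝔞(q)_ℂ`), `wordDerAt_incl₂_eq_zero_of_times_rigidBlocks`,
  `incl₁_theta_proj_mem_spanC_annLie_of_times_rigidBlocks` (`Θ₁ ⊕ 0 ∈ 𝔞(q)_ℂ`) and the consumer-facing
  `wordDerAt_incl_proj_theta_eq_zero_of_times_rigidBlocks` (same shape as
  `wordDerAt_incl_proj_theta_eq_zero_of_times_rigidSymplectic`, with `(hV₂, hrigid)` replaced by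
  `(hself₂, τ, hint, hrigid)`), which feeds the typed-Künneth pipeline of
  `HodgeTheory/TimesGenericStablyNondegenerateProductSpan` verbatim.

No hypothesis is made on `V₁` (Moonen–Zarhin use `hg(X₁)` only through reductivity), none on the number or the ranks of
the blocks (an empty block contributes the zero algebra), and `V₂ = 0` is allowed (then `Lie Hg(H₂) = 0`).

## References

* [MoonenZarhin1999LowDim] B. Moonen, Yu. G. Zarhin, Math. Ann. 315 (1999) 711–733, §3 (3.1), Lemma (3.3), Lemma (3.4),
  Thm. (3.2)(1) (held: `paper:arxiv-math_9901113` pp. 6–7). [cite: MoonenZarhin1999LowDim, §3 Lemma (3.3) and Lemma (3.4)]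
* [Hazama1989] F. Hazama, Duke Math. J. 58 (1989) 31–37 (Goursat for Hodge Lie algebras; = Gordon's survey Thm. 7.6.2).
  [cite: Hazama1989, Thm. (= Gordon 7.6.2)]
* [Hazama1983] F. Hazama, Tôhoku Math. J. 35 (1983), §3 pp. 305–306 (the blocks `H¹ ⊗ ℂ = ⊕ V_i` of the places).
  [cite: Hazama1983, §3 (pp. 305–306)]
* [Deligne1982HodgeCycles] P. Deligne, LNM 900 (1982), I §3 Prop. 3.4 (minimality, descent), Prop. 3.6 (reductivity).
  [cite: Deligne1982HodgeCycles, I §3 Prop. 3.4 and Prop. 3.6]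
* [GoodmanWallachGTM255] R. Goodman, N. R. Wallach, GTM 255 (2009), §2.1.2, §4.1.1. [cite: GoodmanWallachGTM255, §2.1.2 and §4.1.1]
-/

noncomputable section

open scoped TensorProduct
open CategoryTheory Module

namespace Literature.AlgebraicGeometry.Motives

namespace HodgeStructure

open Literature.RepresentationTheory.GeneralLinear

/-! ### §0 Two lemmas of complex symplectic linear algebra: a linear map on `𝔰𝔭(M, ω)` killing the `T`-brackets and
closed under brackets of killed elements vanishes; `P ≠ 0` -/

section WeightVanishing

variable {M : Type*} [AddCommGroup M] [Module ℂ M] {X : Type*} [AddCommGroup X] [Module ℂ X]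

/-- **The Levi is generated by brackets of root vectors (Θ-weight vanishing).** Setting: `ω` nondegenerate alternating
on a finite-dimensional complex `M`, `T` an `ω`-skew involution with eigenspaces `P`, `Q`; `σ : End(M) → X` linear with
(i) `σ[T, Y] = 0` for every `ω`-skew `Y` and (ii) `σ[Y, Y'] = 0` whenever `σ Y = σ Y' = 0` (`Y`, `Y'` skew). Then `σ`
vanishes on `𝔰𝔭(M, ω)`: `Y - TYT = ½[T,[T,Y]]` is killed by (i); the Levi part `½(Y + TYT)` is `-∑ Y_{L bᵢ, qᵢ}`
(`levi_eq_neg_sum_pairOp`) and `ω(p,q) Y_{p,q} = [R_p, R_q]` with `R_a = ω(a,·) ⊗ a = ±½[T, R_a]` killed by (i), so (ii)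
applies. (The `J`-eigenvalue bookkeeping of Moonen–Zarhin's Lemma (3.3) — «both `i + λ` and `-i + λ` occur as eigenvalues …
possible only if `λ = 0`» — in the operator form used for a second factor with SEVERAL symplectic blocks: the root vectors of
one block raise/lower the `Θ`-weight by `2`, which no equivariant map out of another block tolerates.)
[cite: MoonenZarhin1999LowDim, §3 Lemma (3.3)] [cite: GoodmanWallachGTM255, §2.1.2 and §4.1.1] -/
theorem SymplecticWitness.eq_zero_of_theta_bracket_of_bracket [FiniteDimensional ℂ M]
    (ω : LinearMap.BilinForm ℂ M) (hωnd : ω.Nondegenerate) (hωalt : ∀ x y, ω x y = -ω y x)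
    {T : Module.End ℂ M} (hTT : ∀ v, T (T v) = v) (hTskew : ∀ x y, ω (T x) y + ω x (T y) = 0)
    {P Q : Submodule ℂ M} (hP : ∀ x ∈ P, T x = x) (hQ : ∀ x ∈ Q, T x = -x)
    (hPmem : ∀ v, (2 : ℂ)⁻¹ • (v + T v) ∈ P) (hQmem : ∀ v, (2 : ℂ)⁻¹ • (v - T v) ∈ Q)
    (σ : Module.End ℂ M →ₗ[ℂ] X)
    (h1 : ∀ Y : Module.End ℂ M, (∀ x y, ω (Y x) y + ω x (Y y) = 0) → σ (T * Y - Y * T) = 0)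
    (h2 : ∀ Y Y' : Module.End ℂ M, (∀ x y, ω (Y x) y + ω x (Y y) = 0) → (∀ x y, ω (Y' x) y + ω x (Y' y) = 0) →
      σ Y = 0 → σ Y' = 0 → σ (Y * Y' - Y' * Y) = 0)
    {Y : Module.End ℂ M} (hY : ∀ x y, ω (Y x) y + ω x (Y y) = 0) : σ Y = 0 := by
  classical
  have hT2 : T * T = 1 := LinearMap.ext fun v => by rw [Module.End.mul_apply, hTT, Module.End.one_apply]
  have hPP := SymplecticIdeal.isotropic_of_skew_involution ω hTskew hP
  have hdetP : ∀ x ∈ P, (∀ q ∈ Q, ω x q = 0) → x = 0 :=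
    fun x hx hxQ => SymplecticIdeal.eq_zero_of_forall_Q ω hωnd hTskew hP hPmem hQmem hx hxQ
  have hdetQ : ∀ y ∈ Q, (∀ p ∈ P, ω p y = 0) → y = 0 :=
    fun y hy hyP => SymplecticIdeal.eq_zero_of_forall_P ω hωnd hωalt hTskew hQ hPmem hQmem hy hyP
  have hTfix : ∀ x, T x = x → x ∈ P := fun x hx => by
    have h := hPmem x
    rwa [hx, ← two_smul ℂ x, smul_smul, inv_mul_cancel₀ (two_ne_zero' ℂ), one_smul] at h
  have hωTP : ∀ a ∈ P, ∀ v, ω a (T v) = -ω a v := fun a ha v => by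
    have h := hTskew a v
    rw [hP a ha] at h
    linear_combination h
  have hωTQ : ∀ a ∈ Q, ∀ v, ω a (T v) = ω a v := fun a ha v => by
    have h := hTskew a v
    rw [hQ a ha, map_neg, LinearMap.neg_apply] at h
    linear_combination h
  -- skewness is preserved by brackets
  have hbr : ∀ Y Y' : Module.End ℂ M, (∀ x y, ω (Y x) y + ω x (Y y) = 0) →
      (∀ x y, ω (Y' x) y + ω x (Y' y) = 0) → ∀ x y, ω ((Y * Y' - Y' * Y) x) y + ω x ((Y * Y' - Y' * Y) y) = 0 := by
    intro Y Y' hY hY' x y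
    simp only [LinearMap.sub_apply, Module.End.mul_apply, map_sub, LinearMap.sub_apply]
    have e1 := hY (Y' x) y
    have e2 := hY' x (Y y)
    have e3 := hY' (Y x) y
    have e4 := hY x (Y' y)
    linear_combination e1 - e3 + e4 - e2
  -- root vectors `R_a`, `a ∈ P ∪ Q`, are killed: `[T, R_a] = ±2 R_a`
  have hRskew : ∀ a : M, ∀ x y, ω ((ω a).smulRight a x) y + ω x ((ω a).smulRight a y) = 0 :=
    fun a => SymplecticIdeal.smulRight_self_skew ω hωalt a
  have hσR_P : ∀ a ∈ P, σ ((ω a).smulRight a) = 0 := by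
    intro a ha
    have hTR : T * (ω a).smulRight a - (ω a).smulRight a * T = (2 : ℂ) • (ω a).smulRight a := by
      apply LinearMap.ext
      intro v
      simp only [LinearMap.sub_apply, Module.End.mul_apply, LinearMap.smul_apply, LinearMap.smulRight_apply,
        map_smul, hP a ha, hωTP a ha]
      module
    have h := h1 _ (hRskew a)
    rw [hTR, map_smul, smul_eq_zero] at h
    exact h.resolve_left two_ne_zero
  have hσR_Q : ∀ a ∈ Q, σ ((ω a).smulRight a) = 0 := by
    intro a ha
    have hTR : T * (ω a).smulRight a - (ω a).smulRight a * T = -((2 : ℂ) • (ω a).smulRight a) := by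
      apply LinearMap.ext
      intro v
      simp only [LinearMap.sub_apply, Module.End.mul_apply, LinearMap.smul_apply, LinearMap.smulRight_apply,
        LinearMap.neg_apply, map_smul, hQ a ha, hωTQ a ha]
      module
    have h := h1 _ (hRskew a)
    rw [hTR, map_neg, map_smul, neg_eq_zero, smul_eq_zero] at h
    exact h.resolve_left two_ne_zero
  -- pair operators `Y_{p,q}`, `p ∈ P`, `q ∈ Q`, are killed: `ω(p,q) Y_{p,q} = [R_p, R_q]`
  have hσY_of_ne : ∀ p ∈ P, ∀ q ∈ Q, ω p q ≠ 0 → σ ((ω p).smulRight q + (ω q).smulRight p) = 0 := by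
    intro p hp q hq hpq
    have h := h2 _ _ (hRskew p) (hRskew q) (hσR_P p hp) (hσR_Q q hq)
    rw [SymplecticWitness.smulRight_self_bracket_smulRight_self ω hωalt p q, map_smul, smul_eq_zero] at h
    exact h.resolve_left hpq
  have hσY : ∀ p ∈ P, ∀ q ∈ Q, σ ((ω p).smulRight q + (ω q).smulRight p) = 0 := by
    intro p hp q hq
    by_cases hpq : ω p q ≠ 0
    · exact hσY_of_ne p hp q hq hpq
    rw [not_not] at hpq
    by_cases hp0 : p = 0
    · rw [hp0, SymplecticWitness.pairOp_zero_left, map_zero]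
    obtain ⟨q', hq', hpq'⟩ : ∃ q' ∈ Q, ω p q' ≠ 0 := by
      by_contra h
      push Not at h
      exact hp0 (hdetP p hp h)
    have hsum : ω p (q + q') ≠ 0 := by rw [map_add, hpq, zero_add]; exact hpq'
    have hsplit : (ω p).smulRight q + (ω q).smulRight p =
        ((ω p).smulRight (q + q') + (ω (q + q')).smulRight p) - ((ω p).smulRight q' + (ω q').smulRight p) := by
      rw [SymplecticWitness.pairOp_comm ω p (q + q'), SymplecticWitness.pairOp_add_left ω q q' p,
        SymplecticWitness.pairOp_comm ω q p, SymplecticWitness.pairOp_comm ω q' p]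
      abel
    rw [hsplit, map_sub, hσY_of_ne p hp _ (Q.add_mem hq hq') hsum, hσY_of_ne p hp q' hq' hpq', sub_zero]
  -- the Levi part `L = ½(Y + TYT)` of `Y`
  set L : Module.End ℂ M := (2 : ℂ)⁻¹ • (Y + T * Y * T) with hL
  have hTYT : ∀ x y, ω ((T * Y * T) x) y + ω x ((T * Y * T) y) = 0 := by
    intro x y
    simp only [Module.End.mul_apply]
    have e1 := hTskew (Y (T x)) y
    have e2 := hY (T x) (T y)
    have e3 := hTskew x (Y (T y))
    linear_combination e1 - e2 + e3
  have hLskew : ∀ x y, ω (L x) y + ω x (L y) = 0 := by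
    intro x y
    simp only [hL, LinearMap.smul_apply, LinearMap.add_apply, map_smul, map_add, LinearMap.smul_apply,
      LinearMap.add_apply, smul_eq_mul]
    have e1 := hY x y
    have e2 := hTYT x y
    linear_combination (2 : ℂ)⁻¹ * e1 + (2 : ℂ)⁻¹ * e2
  have hLT : ∀ v, T (L v) = L (T v) := by
    intro v
    simp only [hL, LinearMap.smul_apply, LinearMap.add_apply, Module.End.mul_apply, map_smul, map_add, hTT]
    rw [add_comm (T (Y v)) (Y (T v))]
  -- `Y - L = ¼[T,[T,Y]]` is killed by (i)
  have hYL : Y - L = (4 : ℂ)⁻¹ • (T * (T * Y - Y * T) - (T * Y - Y * T) * T) := by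
    rw [mul_sub, sub_mul, ← mul_assoc, hT2, one_mul, mul_assoc Y T T, hT2, mul_one, hL, ← mul_assoc]
    module
  have hσYL : σ (Y - L) = 0 := by
    rw [hYL, map_smul, h1 _ (hbr _ _ hTskew hY), smul_zero]
  -- the Levi part is a sum of pair operators (dual system along a basis of `P`)
  have hσL : σ L = 0 := by
    obtain ⟨b⟩ : Nonempty (Module.Basis (Fin (Module.finrank ℂ ↥P)) ℂ ↥P) := ⟨Module.finBasis ℂ ↥P⟩
    obtain ⟨q, hqQ, hq⟩ := SymplecticThetaSix.exists_dual_family ω hdetP hdetQ b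
    have hLP : ∀ p ∈ P, L p ∈ P := fun p hp => hTfix _ (by rw [hLT, hP p hp])
    rw [SymplecticWitness.levi_eq_neg_sum_pairOp ω hωnd hωalt hTskew hP hQ hPmem hQmem b hqQ hq hLskew hLT,
      map_neg, map_sum, neg_eq_zero]
    exact Finset.sum_eq_zero fun i _ => hσY _ (hLP _ (b i).2) _ (hqQ i)
  have h : σ Y = σ (Y - L) + σ L := by rw [map_sub, sub_add_cancel]
  rw [h, hσYL, hσL, add_zero]

/-- **`P ≠ 0` on a non-zero block**: if the `+1`-eigenspace `P` of the `ω`-skew involution `T` vanished, `T = -1`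
and `ω = 0`, contradicting non-degeneracy. [cite: GoodmanWallachGTM255, §1.1.2] -/
theorem SymplecticWitness.P_ne_bot_of_nontrivial [Nontrivial M] (ω : LinearMap.BilinForm ℂ M) (hωnd : ω.Nondegenerate)
    {T : Module.End ℂ M} (hTskew : ∀ x y, ω (T x) y + ω x (T y) = 0) {P : Submodule ℂ M}
    (hPmem : ∀ v, (2 : ℂ)⁻¹ • (v + T v) ∈ P) : P ≠ ⊥ := by
  intro hP0
  have hTv : ∀ v, T v = -v := fun v => by
    have h := hPmem v
    rw [hP0, Submodule.mem_bot, smul_eq_zero] at h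
    exact eq_neg_of_add_eq_zero_right (h.resolve_left (inv_ne_zero (two_ne_zero' ℂ)))
  obtain ⟨x, hx⟩ := exists_ne (0 : M)
  refine hx (hωnd.1 x fun y => ?_)
  have h := hTskew x y
  rw [hTv, hTv, map_neg, LinearMap.neg_apply, map_neg, ← neg_add, neg_eq_zero, ← two_smul ℂ (ω x y),
    smul_eq_zero] at h
  exact h.resolve_left (two_ne_zero' ℂ)

end WeightVanishing

/-! ### §1 Block calculus for an internal direct sum `W = ⊕ᵢ Tᵢ`: the projections `pᵢ : W → Tᵢ` -/

section Blocks

variable {W : Type*} [AddCommGroup W] [Module ℂ W] {ι : Type*} [Fintype ι] [DecidableEq ι]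

/-- **Projections of an internal direct sum.** For `W = ⊕ᵢ Tᵢ` internal there are linear `pᵢ : W → Tᵢ` with `pᵢ|_{Tᵢ} = id`,
`pᵢ|_{Tⱼ} = 0` (`j ≠ i`), `∑ᵢ pᵢ = id`, and `pᵢ ∘ Y = Y|_{Tᵢ} ∘ pᵢ` for every block-preserving `Y` (the projection onto `Tᵢ`
along `⊕_{j ≠ i} Tⱼ`, Mathlib's `Submodule.projectionOnto`). [folklore] -/
private theorem Blocks.exists_proj (T : ι → Submodule ℂ W) (hint : DirectSum.IsInternal T) :
    ∃ p : ∀ i, W →ₗ[ℂ] ↥(T i), (∀ i (x : T i), p i x = x) ∧ (∀ i j, j ≠ i → ∀ x ∈ T j, p i x = 0) ∧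
      (∀ x, ∑ i, ((p i x : T i) : W) = x) ∧
      (∀ Y : Module.End ℂ W, (∀ i, Set.MapsTo Y (T i) (T i)) → ∀ i x, ((p i (Y x) : T i) : W) = Y (p i x)) := by
  classical
  have hind : iSupIndep T := hint.submodule_iSupIndep
  have htop : ⨆ i, T i = ⊤ := hint.submodule_iSup_eq_top
  have hC : ∀ i, IsCompl (T i) (⨆ (j) (_ : j ≠ i), T j) := fun i =>
    ⟨(iSupIndep_def.1 hind) i, by
      rw [codisjoint_iff, ← iSup_split_single T i]
      exact htop⟩
  set p : ∀ i, W →ₗ[ℂ] ↥(T i) := fun i => Submodule.projectionOnto (T i) (⨆ (j) (_ : j ≠ i), T j) (hC i) with hp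
  have hp1 : ∀ i (x : T i), p i x = x := fun i x => Submodule.projectionOnto_apply_left (hC i) x
  have hp2 : ∀ i j, j ≠ i → ∀ x ∈ T j, p i x = 0 := by
    intro i j hji x hx
    have hxC : x ∈ ⨆ (j) (_ : j ≠ i), T j :=
      Submodule.mem_iSup_of_mem j (Submodule.mem_iSup_of_mem hji hx)
    exact Submodule.projectionOnto_apply_right (hC i) ⟨x, hxC⟩
  have hp3 : ∀ x, ∑ i, ((p i x : T i) : W) = x := by
    intro x
    have hx : x ∈ ⨆ i, T i := by rw [htop]; exact Submodule.mem_top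
    induction hx using Submodule.iSup_induction' with
    | mem k x hx =>
      rw [Finset.sum_eq_single k]
      · rw [Submodule.projectionOnto_apply_of_mem_left (hC k) hx]
      · intro i _ hik
        rw [hp2 i k (Ne.symm hik) x hx, Submodule.coe_zero]
      · intro hk; exact absurd (Finset.mem_univ k) hk
    | zero => simp
    | add x y _ _ hx hy =>
      conv_rhs => rw [← hx, ← hy]
      rw [← Finset.sum_add_distrib]
      exact Finset.sum_congr rfl fun i _ => by rw [map_add, Submodule.coe_add]
  refine ⟨p, hp1, hp2, hp3, fun Y hY i x => ?_⟩
  conv_lhs => rw [← hp3 x, map_sum, map_sum]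
  rw [Submodule.coe_sum, Finset.sum_eq_single i]
  · rw [Submodule.projectionOnto_apply_of_mem_left (hC i) (hY i (p i x).2)]
  · intro k _ hki
    rw [hp2 i k hki _ (hY k (p k x).2), Submodule.coe_zero]
  · intro hi; exact absurd (Finset.mem_univ i) hi

end Blocks

/-! ### §2 The Goursat step for a second factor with rigid symplectic BLOCKS: `Hom = 0` kills the graph -/

section Goursat

universe u

variable {U V₁ V₂ : Type u} [AddCommGroup U] [Module ℚ U] [AddCommGroup V₁] [Module ℚ V₁]
  [AddCommGroup V₂] [Module ℚ V₂] [Module.Finite ℚ U] [Module.Finite ℚ V₁] [Module.Finite ℚ V₂]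
  [HodgeTensorFacts.{u, u}] {n : ℤ} {κ : Type} [Fintype κ] [DecidableEq κ]

set_option maxHeartbeats 800000 in
/-- **The Goursat step for a second factor with rigid symplectic blocks (Moonen–Zarhin Lemma (3.4), Lie form, for
`hg(X₂) ⊗ ℂ = ⊕ᵢ 𝔰𝔭(Tᵢ)`).** Let `U = ι₁V₁ ⊕ ι₂V₂` and let `𝔞 ⊆ End_ℚ(U)` be a bracket-closed space of block-diagonal
operators with `ψ₁`-skew first corners, whose complex span contains an operator `Θ_U` inducing the Hodge operators `Θ₁`, `Θ₂`
of the effective weight-one structures `H₁`, `H₂` on the blocks. On `V₂`: every Hodge endomorphism is `ψ₂`-self-adjoint,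
the eigenblocks `Tᵢ` of a family of characters `τᵢ` of `End_Hdg(V₂)` form an internal direct sum `V₂ ⊗ ℂ = ⊕ᵢ Tᵢ`, and
(RIGID BLOCKS) every block-preserving `ψ₂ ⊗ ℂ`-skew operator lies in `Lie Hg(H₂) ⊗ ℂ` (so `Lie Hg(H₂) ⊗ ℂ = ⊕ᵢ 𝔰𝔭(Tᵢ)`:
the tree's theorems for real multiplication by a totally real field, `Hg = R_{F/ℚ} Sp_{2m,F}`). If NO non-zero `ℚ`-linear
`f : V₂ → V₁` intertwines `Θ₂` and `Θ₁` («`Hom(X₂, X₁) = 0`»), then `ι₂ Z π₂ ∈ 𝔞` for every `Z ∈ Lie Hg(H₂)`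
(«`Hg(X₁ × X₂) ⊇ 1 × Hg(X₂)`»). PROOF (Hazama's Goursat argument, Moonen–Zarhin (3.1)–(3.4)). `𝔤₂ = c₂(𝔞) ⊇ 𝔥 = Lie Hg(H₂)`
(Deligne's minimality `hodgeLie_rigid`). The ideal `𝔨₁ = c₁(𝔞 ∩ ker c₂)` of `𝔤₁ = c₁(𝔞)` has a complementary ideal `𝔤₃`
(`exists_ideal_compl`); `𝔞₃ = 𝔞 ∩ c₁⁻¹(𝔤₃)` maps isomorphically onto `𝔤₂` under `c₂`, and `𝔞₃' = 𝔞₃ ∩ c₂⁻¹(𝔥)` onto `𝔥`;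
`ρ = c₁ ∘ c₂⁻¹ : 𝔥_ℂ → End(V₁ ⊗ ℂ)` preserves brackets and `ρ[Θ₂, Y] = [Θ₁, ρY]`. CLAIM: `ρ = 0` on each `𝔰𝔭(T_k) ⊆ 𝔥_ℂ`.
The kernel of `ρ` on `𝔰𝔭(T_k)` is an ideal; if non-zero it contains `Θ|_{T_k}` (`SymplecticIdeal.theta_mem_of_ne_bot`,
«`𝔰𝔭` is simple») and then `ρ|_{𝔰𝔭(T_k)} = 0` (§0); if zero, `SymplecticWitness.exists_equivariant_ne_zero` (the standard
representation is the only length-one representation) gives a non-zero `ρ`-equivariant `F : T_k → V₁ ⊗ ℂ`; by §0 (the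
`Θ`-weights of the root vectors of the OTHER blocks) `ρ(𝔰𝔭(T_j)) F = 0` for `j ≠ k`, so `Z' = ι₁ F p_k π₂` commutes with
`(𝔞₃')_ℂ`; by descent of commutants (`mem_span_baseChange_of_forall_commute`) it is a complex combination of RATIONAL `Z`
commuting with `𝔞₃'`, whose corners `π₁ Z ι₂` are `ρ`-equivariant, hence intertwine `Θ₂` and `Θ₁` block by block
(`SymplecticWitness.theta_comp_eq_of_equivariant`) and vanish by (HOM) — contradiction. Hence `c₁` kills `𝔞₃'`, i.e.
`𝔞₃' ⊆ 𝔞 ∩ ker c₁`, and every `Z ∈ 𝔥 = c₂(𝔞₃')` is `c₂` of an element `ι₂ Z π₂` of `𝔞`.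
[cite: MoonenZarhin1999LowDim, §3 (3.1), Lemma (3.3), Lemma (3.4)] [cite: Hazama1989, Thm. (= Gordon 7.6.2)]
[cite: Deligne1982HodgeCycles, I §3 (proof of Prop. 3.4) and Prop. 3.6] -/
theorem goursat_incl₂_mem_of_hom_eq_zero_of_rigidBlocks (hn : n = 1) (H₁ : HodgeStructure V₁ n)
    (H₂ : HodgeStructure V₂ n) (heff₁ : H₁.IsEffective) (heff₂ : H₂.IsEffective)
    {ι₁ : V₁ →ₗ[ℚ] U} {π₁ : U →ₗ[ℚ] V₁} {ι₂ : V₂ →ₗ[ℚ] U} {π₂ : U →ₗ[ℚ] V₂}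
    (hπι₁ : π₁ ∘ₗ ι₁ = LinearMap.id) (hπι₂ : π₂ ∘ₗ ι₂ = LinearMap.id) (hπ₁ι₂ : π₁ ∘ₗ ι₂ = 0)
    (hπ₂ι₁ : π₂ ∘ₗ ι₁ = 0) (hsum : ι₁ ∘ₗ π₁ + ι₂ ∘ₗ π₂ = LinearMap.id)
    (𝔞 : Submodule ℚ (Module.End ℚ U)) (hbr : ∀ X ∈ 𝔞, ∀ X' ∈ 𝔞, X * X' - X' * X ∈ 𝔞)
    (hP₁ : ∀ X ∈ 𝔞, X * (ι₁ ∘ₗ π₁) = (ι₁ ∘ₗ π₁) * X) (hP₂ : ∀ X ∈ 𝔞, X * (ι₂ ∘ₗ π₂) = (ι₂ ∘ₗ π₂) * X)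
    (ψ₁ : H₁.Polarization) (ψ₂ : H₂.Polarization)
    (hskew₁ : ∀ X ∈ 𝔞, ∀ v w, ψ₁.form ((π₁ ∘ₗ X ∘ₗ ι₁) v) w + ψ₁.form v ((π₁ ∘ₗ X ∘ₗ ι₁) w) = 0)
    {Θ₁ : Module.End ℂ (ℂ ⊗[ℚ] V₁)} (hΘ₁ : ∀ p, ∀ x ∈ H₁.piece p (n - p), Θ₁ x = ((2 * p - n : ℤ) : ℂ) • x)
    {Θ₂ : Module.End ℂ (ℂ ⊗[ℚ] V₂)} (hΘ₂ : ∀ p, ∀ x ∈ H₂.piece p (n - p), Θ₂ x = ((2 * p - n : ℤ) : ℂ) • x)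
    (hself₂ : ∀ a : H₂.endAlg, LinearMap.IsAdjointPair ψ₂.form ψ₂.form (a : Module.End ℚ V₂) (a : Module.End ℚ V₂))
    (τ : κ → (H₂.endAlg →+* ℂ)) (hint : DirectSum.IsInternal fun k => H₂.eigenBlock (τ k))
    (hrigid : ∀ Y : Module.End ℂ (ℂ ⊗[ℚ] V₂), (∀ k, Set.MapsTo Y (H₂.eigenBlock (τ k)) (H₂.eigenBlock (τ k))) →
      (∀ x y, ψ₂.form.baseChange ℂ (Y x) y + ψ₂.form.baseChange ℂ x (Y y) = 0) → Y ∈ H₂.hodgeLieC)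
    {ΘU : Module.End ℂ (ℂ ⊗[ℚ] U)} (hΘU𝔞 : ΘU ∈ spanC 𝔞)
    (hΘUι₁ : ∀ x, ΘU (ι₁.baseChange ℂ x) = ι₁.baseChange ℂ (Θ₁ x))
    (hΘUι₂ : ∀ x, ΘU (ι₂.baseChange ℂ x) = ι₂.baseChange ℂ (Θ₂ x))
    (hHom : ∀ f : V₂ →ₗ[ℚ] V₁, Θ₁ ∘ₗ f.baseChange ℂ = f.baseChange ℂ ∘ₗ Θ₂ → f = 0) :
    ∀ Z₂ ∈ H₂.hodgeLie, ι₂ ∘ₗ Z₂ ∘ₗ π₂ ∈ 𝔞 := by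
  classical
  have hsum' : ι₂ ∘ₗ π₂ + ι₁ ∘ₗ π₁ = LinearMap.id := by rw [add_comm]; exact hsum
  -- the corner maps as linear maps, rational and complex
  obtain ⟨cL₁, hcL₁⟩ : ∃ L : Module.End ℚ U →ₗ[ℚ] Module.End ℚ V₁, ∀ X, L X = π₁ ∘ₗ X ∘ₗ ι₁ :=
    ⟨{ toFun := fun X => π₁ ∘ₗ X ∘ₗ ι₁
       map_add' := fun X X' => by rw [LinearMap.add_comp, LinearMap.comp_add]
       map_smul' := fun c X => by rw [LinearMap.smul_comp, LinearMap.comp_smul, RingHom.id_apply] },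
      fun X => rfl⟩
  obtain ⟨cL₂, hcL₂⟩ : ∃ L : Module.End ℚ U →ₗ[ℚ] Module.End ℚ V₂, ∀ X, L X = π₂ ∘ₗ X ∘ₗ ι₂ :=
    ⟨{ toFun := fun X => π₂ ∘ₗ X ∘ₗ ι₂
       map_add' := fun X X' => by rw [LinearMap.add_comp, LinearMap.comp_add]
       map_smul' := fun c X => by rw [LinearMap.smul_comp, LinearMap.comp_smul, RingHom.id_apply] },
      fun X => rfl⟩
  obtain ⟨LC₁, hLC₁⟩ : ∃ L : Module.End ℂ (ℂ ⊗[ℚ] U) →ₗ[ℂ] Module.End ℂ (ℂ ⊗[ℚ] V₁),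
      ∀ T, L T = π₁.baseChange ℂ ∘ₗ T ∘ₗ ι₁.baseChange ℂ :=
    ⟨{ toFun := fun T => π₁.baseChange ℂ ∘ₗ T ∘ₗ ι₁.baseChange ℂ
       map_add' := fun T T' => by rw [LinearMap.add_comp, LinearMap.comp_add]
       map_smul' := fun c T => by rw [LinearMap.smul_comp, LinearMap.comp_smul, RingHom.id_apply] },
      fun T => rfl⟩
  obtain ⟨LC₂, hLC₂⟩ : ∃ L : Module.End ℂ (ℂ ⊗[ℚ] U) →ₗ[ℂ] Module.End ℂ (ℂ ⊗[ℚ] V₂),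
      ∀ T, L T = π₂.baseChange ℂ ∘ₗ T ∘ₗ ι₂.baseChange ℂ :=
    ⟨{ toFun := fun T => π₂.baseChange ℂ ∘ₗ T ∘ₗ ι₂.baseChange ℂ
       map_add' := fun T T' => by rw [LinearMap.add_comp, LinearMap.comp_add]
       map_smul' := fun c T => by rw [LinearMap.smul_comp, LinearMap.comp_smul, RingHom.id_apply] },
      fun T => rfl⟩
  have hLC₁c : ∀ X : Module.End ℚ U, LC₁ (X.baseChange ℂ) = (cL₁ X).baseChange ℂ := fun X => by
    rw [hLC₁, hcL₁, LinearMap.baseChange_comp, LinearMap.baseChange_comp]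
  have hLC₂c : ∀ X : Module.End ℚ U, LC₂ (X.baseChange ℂ) = (cL₂ X).baseChange ℂ := fun X => by
    rw [hLC₂, hcL₂, LinearMap.baseChange_comp, LinearMap.baseChange_comp]
  -- corners of brackets
  have hc₁br : ∀ X ∈ 𝔞, ∀ X' ∈ 𝔞, π₁ ∘ₗ (X * X' - X' * X) ∘ₗ ι₁ =
      (π₁ ∘ₗ X ∘ₗ ι₁) * (π₁ ∘ₗ X' ∘ₗ ι₁) - (π₁ ∘ₗ X' ∘ₗ ι₁) * (π₁ ∘ₗ X ∘ₗ ι₁) := fun X hX X' hX' =>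
    corner_bracket hπι₁ hπι₂ hπ₁ι₂ hsum (hP₁ X hX) (hP₂ X hX) (hP₁ X' hX') (hP₂ X' hX')
  have hc₂br : ∀ X ∈ 𝔞, ∀ X' ∈ 𝔞, π₂ ∘ₗ (X * X' - X' * X) ∘ₗ ι₂ =
      (π₂ ∘ₗ X ∘ₗ ι₂) * (π₂ ∘ₗ X' ∘ₗ ι₂) - (π₂ ∘ₗ X' ∘ₗ ι₂) * (π₂ ∘ₗ X ∘ₗ ι₂) := fun X hX X' hX' =>
    corner_bracket hπι₂ hπι₁ hπ₂ι₁ hsum' (hP₂ X hX) (hP₁ X hX) (hP₂ X' hX') (hP₁ X' hX')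
  -- the corner algebras `𝔤₁ = c₁(𝔞)`, `𝔤₂ = c₂(𝔞)`
  set 𝔤₁ : Submodule ℚ (Module.End ℚ V₁) := 𝔞.map cL₁ with h𝔤₁
  have h𝔤₁mem : ∀ {Y}, Y ∈ 𝔤₁ ↔ ∃ X ∈ 𝔞, π₁ ∘ₗ X ∘ₗ ι₁ = Y := by
    intro Y
    rw [h𝔤₁, Submodule.mem_map]
    simp only [hcL₁]
  have hbr𝔤₁ : ∀ Y ∈ 𝔤₁, ∀ Y' ∈ 𝔤₁, Y * Y' - Y' * Y ∈ 𝔤₁ := by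
    intro Y hY Y' hY'
    obtain ⟨X, hX, rfl⟩ := h𝔤₁mem.1 hY
    obtain ⟨X', hX', rfl⟩ := h𝔤₁mem.1 hY'
    exact h𝔤₁mem.2 ⟨_, hbr X hX X' hX', hc₁br X hX X' hX'⟩
  have hskew𝔤₁ : ∀ Y ∈ 𝔤₁, ∀ v w, ψ₁.form (Y v) w + ψ₁.form v (Y w) = 0 := by
    intro Y hY v w
    obtain ⟨X, hX, rfl⟩ := h𝔤₁mem.1 hY
    exact hskew₁ X hX v w
  set 𝔤₂ : Submodule ℚ (Module.End ℚ V₂) := 𝔞.map cL₂ with h𝔤₂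
  have h𝔤₂mem : ∀ {Y}, Y ∈ 𝔤₂ ↔ ∃ X ∈ 𝔞, π₂ ∘ₗ X ∘ₗ ι₂ = Y := by
    intro Y
    rw [h𝔤₂, Submodule.mem_map]
    simp only [hcL₂]
  have hbr𝔤₂ : ∀ Y ∈ 𝔤₂, ∀ Y' ∈ 𝔤₂, Y * Y' - Y' * Y ∈ 𝔤₂ := by
    intro Y hY Y' hY'
    obtain ⟨X, hX, rfl⟩ := h𝔤₂mem.1 hY
    obtain ⟨X', hX', rfl⟩ := h𝔤₂mem.1 hY'
    exact h𝔤₂mem.2 ⟨_, hbr X hX X' hX', hc₂br X hX X' hX'⟩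
  -- `Θ_i = c_i(Θ_U) ∈ (𝔤_i)_ℂ`
  have hΘ₁eq : LC₁ ΘU = Θ₁ := by
    rw [hLC₁]
    apply LinearMap.ext
    intro x
    rw [LinearMap.comp_apply, LinearMap.comp_apply, hΘUι₁, proj_incl_baseChange hπι₁]
  have hΘ₂eq : LC₂ ΘU = Θ₂ := by
    rw [hLC₂]
    apply LinearMap.ext
    intro x
    rw [LinearMap.comp_apply, LinearMap.comp_apply, hΘUι₂, proj_incl_baseChange hπι₂]
  have hΘ𝔤₁ : Θ₁ ∈ spanC 𝔤₁ := by rw [← hΘ₁eq]; exact map_mem_spanC_map cL₁ LC₁ hLC₁c 𝔞 hΘU𝔞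
  have hΘ𝔤₂ : Θ₂ ∈ spanC 𝔤₂ := by rw [← hΘ₂eq]; exact map_mem_spanC_map cL₂ LC₂ hLC₂c 𝔞 hΘU𝔞
  -- `Θ² = 1` on the blocks
  have hΘΘ₁ : ∀ v, Θ₁ (Θ₁ v) = v := theta_theta_apply H₁ hn heff₁ hΘ₁
  have hΘΘ₂ : ∀ v, Θ₂ (Θ₂ v) = v := theta_theta_apply H₂ hn heff₂ hΘ₂
  -- block calculus for elements of `𝔞_ℂ`
  have hPC₁ : ∀ T ∈ spanC 𝔞, T * (ι₁.baseChange ℂ ∘ₗ π₁.baseChange ℂ) = (ι₁.baseChange ℂ ∘ₗ π₁.baseChange ℂ) * T := by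
    intro T hT
    have h := mul_baseChange_eq_of_mem_spanC hP₁ hT
    rwa [LinearMap.baseChange_comp] at h
  have hPC₂ : ∀ T ∈ spanC 𝔞, T * (ι₂.baseChange ℂ ∘ₗ π₂.baseChange ℂ) = (ι₂.baseChange ℂ ∘ₗ π₂.baseChange ℂ) * T := by
    intro T hT
    have h := mul_baseChange_eq_of_mem_spanC hP₂ hT
    rwa [LinearMap.baseChange_comp] at h
  have happlyι₁ : ∀ T ∈ spanC 𝔞, ∀ v, T (ι₁.baseChange ℂ v) = ι₁.baseChange ℂ (LC₁ T v) := by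
    intro T hT v
    have h := congrArg (fun S : Module.End ℂ (ℂ ⊗[ℚ] U) => S (ι₁.baseChange ℂ v)) (hPC₁ T hT)
    simp only [Module.End.mul_apply, LinearMap.comp_apply, proj_incl_baseChange hπι₁] at h
    rw [hLC₁, LinearMap.comp_apply, LinearMap.comp_apply]
    exact h
  have happlyι₂ : ∀ T ∈ spanC 𝔞, ∀ v, T (ι₂.baseChange ℂ v) = ι₂.baseChange ℂ (LC₂ T v) := by
    intro T hT v
    have h := congrArg (fun S : Module.End ℂ (ℂ ⊗[ℚ] U) => S (ι₂.baseChange ℂ v)) (hPC₂ T hT)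
    simp only [Module.End.mul_apply, LinearMap.comp_apply, proj_incl_baseChange hπι₂] at h
    rw [hLC₂, LinearMap.comp_apply, LinearMap.comp_apply]
    exact h
  have hprojT₁ : ∀ T ∈ spanC 𝔞, ∀ y, π₁.baseChange ℂ (T y) = LC₁ T (π₁.baseChange ℂ y) := by
    intro T hT y
    conv_lhs => rw [← incl_proj_add_baseChange hsum y]
    rw [map_add, happlyι₁ T hT, happlyι₂ T hT, map_add, proj_incl_baseChange hπι₁,
      proj_incl_baseChange_eq_zero hπ₁ι₂, add_zero]
  have hprojT₂ : ∀ T ∈ spanC 𝔞, ∀ y, π₂.baseChange ℂ (T y) = LC₂ T (π₂.baseChange ℂ y) := by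
    intro T hT y
    conv_lhs => rw [← incl_proj_add_baseChange hsum y]
    rw [map_add, happlyι₁ T hT, happlyι₂ T hT, map_add, proj_incl_baseChange_eq_zero hπ₂ι₁,
      proj_incl_baseChange hπι₂, zero_add]
  have hLC₁mul : ∀ T T' : Module.End ℂ (ℂ ⊗[ℚ] U), T' ∈ spanC 𝔞 → LC₁ (T * T') = LC₁ T * LC₁ T' := by
    intro T T' hT'
    rw [hLC₁, hLC₁, hLC₁]
    exact cornerC_mul hπι₁ (hPC₁ T' hT')
  have hLC₂mul : ∀ T T' : Module.End ℂ (ℂ ⊗[ℚ] U), T' ∈ spanC 𝔞 → LC₂ (T * T') = LC₂ T * LC₂ T' := by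
    intro T T' hT'
    rw [hLC₂, hLC₂, hLC₂]
    exact cornerC_mul hπι₂ (hPC₂ T' hT')
  -- the Hodge Lie algebra `𝔥` of the second factor, its complex span, and `𝔥 ≤ 𝔤₂` (Deligne's minimality)
  set 𝔥 : Submodule ℚ (Module.End ℚ V₂) := H₂.hodgeLie with h𝔥def
  have h𝔥C : H₂.hodgeLieC = spanC 𝔥 := hodgeLieC_eq_spanC H₂
  have hΘ₂C : Θ₂ ∈ H₂.hodgeLieC := H₂.mem_hodgeLieC_of_forall_piece hΘ₂
  have h𝔥le : 𝔥 ≤ 𝔤₂ := by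
    have hΘ𝔥 : Θ₂ ∈ spanC 𝔥 := h𝔥C ▸ hΘ₂C
    have hΘ' : Θ₂ ∈ spanC (𝔤₂ ⊓ 𝔥) := by rw [spanC_inf_eq]; exact ⟨hΘ𝔤₂, hΘ𝔥⟩
    have hbr' : ∀ X ∈ 𝔤₂ ⊓ 𝔥, ∀ X' ∈ 𝔤₂ ⊓ 𝔥, X * X' - X' * X ∈ 𝔤₂ ⊓ 𝔥 :=
      fun X hX X' hX' => ⟨hbr𝔤₂ X hX.1 X' hX'.1, H₂.commutator_mem_hodgeLie hX.2 hX'.2⟩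
    exact (hodgeLie_rigid H₂ ⟨ψ₂⟩ (𝔤₂ ⊓ 𝔥) inf_le_right hbr' ⟨Θ₂, hΘ', hΘ₂⟩).trans inf_le_left
  -- `𝔞₀ = 𝔞 ∩ ker c₂` and the ideal `𝔨₁ = c₁(𝔞₀)` of `𝔤₁`
  set 𝔞₀ : Submodule ℚ (Module.End ℚ U) := 𝔞 ⊓ LinearMap.ker cL₂ with h𝔞₀
  have h𝔞₀mem : ∀ {X}, X ∈ 𝔞₀ ↔ X ∈ 𝔞 ∧ π₂ ∘ₗ X ∘ₗ ι₂ = 0 := by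
    intro X
    rw [h𝔞₀, Submodule.mem_inf, LinearMap.mem_ker, hcL₂]
  have h𝔞₀ideal : ∀ X' ∈ 𝔞, ∀ X ∈ 𝔞₀, X' * X - X * X' ∈ 𝔞₀ := by
    intro X' hX' X hX
    obtain ⟨hX𝔞, hc₂X⟩ := h𝔞₀mem.1 hX
    refine h𝔞₀mem.2 ⟨hbr X' hX' X hX𝔞, ?_⟩
    rw [hc₂br X' hX' X hX𝔞, hc₂X, mul_zero, zero_mul, sub_zero]
  set 𝔨₁ : Submodule ℚ (Module.End ℚ V₁) := 𝔞₀.map cL₁ with h𝔨₁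
  have h𝔨₁mem : ∀ {Y}, Y ∈ 𝔨₁ ↔ ∃ X ∈ 𝔞₀, π₁ ∘ₗ X ∘ₗ ι₁ = Y := by
    intro Y
    rw [h𝔨₁, Submodule.mem_map]
    simp only [hcL₁]
  have h𝔨₁le : 𝔨₁ ≤ 𝔤₁ := Submodule.map_mono inf_le_left
  have h𝔨₁ideal : ∀ Y ∈ 𝔤₁, ∀ Y' ∈ 𝔨₁, Y * Y' - Y' * Y ∈ 𝔨₁ := by
    intro Y hY Y' hY'
    obtain ⟨X, hX, rfl⟩ := h𝔤₁mem.1 hY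
    obtain ⟨X', hX', rfl⟩ := h𝔨₁mem.1 hY'
    exact h𝔨₁mem.2 ⟨_, h𝔞₀ideal X hX X' hX', hc₁br X hX X' (h𝔞₀mem.1 hX').1⟩
  -- the complementary ideal `𝔤₃` and `𝔞₃ = 𝔞 ∩ c₁⁻¹(𝔤₃)`
  obtain ⟨𝔤₃, -, h𝔤₃ideal, h𝔨𝔤₃inf, h𝔨𝔤₃sup⟩ :=
    exists_ideal_compl H₁ hn heff₁ ψ₁ 𝔤₁ hbr𝔤₁ hΘ₁ hΘ𝔤₁ hskew𝔤₁ h𝔨₁le h𝔨₁ideal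
  set 𝔞₃ : Submodule ℚ (Module.End ℚ U) := 𝔞 ⊓ 𝔤₃.comap cL₁ with h𝔞₃
  have h𝔞₃mem : ∀ {X}, X ∈ 𝔞₃ ↔ X ∈ 𝔞 ∧ π₁ ∘ₗ X ∘ₗ ι₁ ∈ 𝔤₃ := by
    intro X
    rw [h𝔞₃, Submodule.mem_inf, Submodule.mem_comap, hcL₁]
  have h𝔞₃le : 𝔞₃ ≤ 𝔞 := inf_le_left
  have h𝔞₃ideal : ∀ X' ∈ 𝔞, ∀ X ∈ 𝔞₃, X' * X - X * X' ∈ 𝔞₃ := by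
    intro X' hX' X hX
    obtain ⟨hX𝔞, hc₁X⟩ := h𝔞₃mem.1 hX
    refine h𝔞₃mem.2 ⟨hbr X' hX' X hX𝔞, ?_⟩
    rw [hc₁br X' hX' X hX𝔞]
    exact h𝔤₃ideal _ (h𝔤₁mem.2 ⟨X', hX', rfl⟩) _ hc₁X
  -- `c₂` is injective on `𝔞₃` (`𝔨₁ ∩ 𝔤₃ = 0` and the block decomposition of `X`)
  have h𝔞₃inj : ∀ X ∈ 𝔞₃, cL₂ X = 0 → X = 0 := by
    intro X hX h0
    obtain ⟨hX𝔞, hc₁X⟩ := h𝔞₃mem.1 hX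
    have hX0 : X ∈ 𝔞₀ := h𝔞₀mem.2 ⟨hX𝔞, by rw [← hcL₂]; exact h0⟩
    have hzero : π₁ ∘ₗ X ∘ₗ ι₁ ∈ 𝔨₁ ⊓ 𝔤₃ := Submodule.mem_inf.2 ⟨h𝔨₁mem.2 ⟨X, hX0, rfl⟩, hc₁X⟩
    rw [h𝔨𝔤₃inf, Submodule.mem_bot] at hzero
    rw [eq_incl_corner_add hπι₁ hπι₂ hsum (hP₁ X hX𝔞) (hP₂ X hX𝔞), hzero, (h𝔞₀mem.1 hX0).2]
    simp only [LinearMap.zero_comp, LinearMap.comp_zero, add_zero]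
  -- `𝔞 ⊆ 𝔞₀ + 𝔞₃`, so `𝔤₂ = c₂(𝔞) ⊆ c₂(𝔞₃)`
  have h𝔞le : 𝔞 ≤ 𝔞₀ ⊔ 𝔞₃ := by
    intro X hX
    have hc₁ : π₁ ∘ₗ X ∘ₗ ι₁ ∈ 𝔨₁ ⊔ 𝔤₃ := by rw [h𝔨𝔤₃sup]; exact h𝔤₁mem.2 ⟨X, hX, rfl⟩
    obtain ⟨k, hk, g, hg, hkg⟩ := Submodule.mem_sup.1 hc₁
    obtain ⟨X₀, hX₀, rfl⟩ := h𝔨₁mem.1 hk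
    have hX₀𝔞 : X₀ ∈ 𝔞 := (h𝔞₀mem.1 hX₀).1
    refine Submodule.mem_sup.2 ⟨X₀, hX₀, X - X₀, h𝔞₃mem.2 ⟨Submodule.sub_mem _ hX hX₀𝔞, ?_⟩, by abel⟩
    have e : π₁ ∘ₗ (X - X₀) ∘ₗ ι₁ = g := by
      rw [LinearMap.sub_comp, LinearMap.comp_sub, ← hkg]
      abel
    rw [e]
    exact hg
  have h𝔤₂le : 𝔤₂ ≤ 𝔞₃.map cL₂ := by
    intro Y hY
    obtain ⟨X, hX, rfl⟩ := h𝔤₂mem.1 hY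
    obtain ⟨X₀, hX₀, X₃, hX₃, rfl⟩ := Submodule.mem_sup.1 (h𝔞le hX)
    refine Submodule.mem_map.2 ⟨X₃, hX₃, ?_⟩
    rw [hcL₂, LinearMap.add_comp, LinearMap.comp_add, (h𝔞₀mem.1 hX₀).2, zero_add]
  -- `𝔞₃' = 𝔞₃ ∩ c₂⁻¹(𝔥)`: a bracket-closed rational algebra mapped by `c₂` ONTO `𝔥`
  set 𝔞₃' : Submodule ℚ (Module.End ℚ U) := 𝔞₃ ⊓ 𝔥.comap cL₂ with h𝔞₃'
  have h𝔞₃'mem : ∀ {X}, X ∈ 𝔞₃' ↔ X ∈ 𝔞₃ ∧ cL₂ X ∈ 𝔥 := by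
    intro X
    rw [h𝔞₃', Submodule.mem_inf, Submodule.mem_comap]
  have h𝔞₃'le : 𝔞₃' ≤ 𝔞₃ := inf_le_left
  have h𝔞₃'le𝔞 : 𝔞₃' ≤ 𝔞 := h𝔞₃'le.trans h𝔞₃le
  have h𝔞₃'leC : spanC 𝔞₃' ≤ spanC 𝔞 := spanC_mono h𝔞₃'le𝔞
  have hbr𝔞₃' : ∀ X ∈ 𝔞₃', ∀ X' ∈ 𝔞₃', X * X' - X' * X ∈ 𝔞₃' := by
    intro X hX X' hX'
    obtain ⟨hX₃, hXh⟩ := h𝔞₃'mem.1 hX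
    obtain ⟨hX'₃, hX'h⟩ := h𝔞₃'mem.1 hX'
    refine h𝔞₃'mem.2 ⟨h𝔞₃ideal X (h𝔞₃le hX₃) X' hX'₃, ?_⟩
    rw [hcL₂, hc₂br X (h𝔞₃le hX₃) X' (h𝔞₃le hX'₃)]
    rw [hcL₂] at hXh hX'h
    exact H₂.commutator_mem_hodgeLie hXh hX'h
  have h𝔞₃'map : 𝔞₃'.map cL₂ = 𝔥 := by
    apply le_antisymm
    · rintro _ ⟨X, hX, rfl⟩
      exact (h𝔞₃'mem.1 hX).2
    · intro Z hZ
      obtain ⟨X, hX, hXZ⟩ := Submodule.mem_map.1 (h𝔤₂le (h𝔥le hZ))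
      exact Submodule.mem_map.2 ⟨X, h𝔞₃'mem.2 ⟨hX, by rw [hXZ]; exact hZ⟩, hXZ⟩
  have h𝔞₃'injC : ∀ T ∈ spanC 𝔞₃', LC₂ T = 0 → T = 0 := fun T hT hT0 =>
    eq_zero_of_map_eq_zero_of_mem_spanC cL₂ LC₂ hLC₂c 𝔞₃' (fun X hX => h𝔞₃inj X (h𝔞₃'le hX)) hT hT0
  have h𝔞₃injC : ∀ T ∈ spanC 𝔞₃, LC₂ T = 0 → T = 0 := fun T hT hT0 =>
    eq_zero_of_map_eq_zero_of_mem_spanC cL₂ LC₂ hLC₂c 𝔞₃ h𝔞₃inj hT hT0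
  have hLC₂memC : ∀ T ∈ spanC 𝔞₃', LC₂ T ∈ H₂.hodgeLieC := fun T hT => by
    rw [h𝔥C, ← h𝔞₃'map]
    exact map_mem_spanC_map cL₂ LC₂ hLC₂c 𝔞₃' hT
  -- `c₂ : (𝔞₃')_ℂ ≅ 𝔥_ℂ` and `ρ = c₁ ∘ c₂⁻¹`
  set f₃ : ↥(spanC 𝔞₃') →ₗ[ℂ] ↥(H₂.hodgeLieC) :=
    (LC₂.domRestrict (spanC 𝔞₃')).codRestrict H₂.hodgeLieC (fun T => hLC₂memC T.1 T.2) with hf₃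
  have hf₃apply : ∀ T : ↥(spanC 𝔞₃'), (f₃ T : Module.End ℂ (ℂ ⊗[ℚ] V₂)) = LC₂ T := fun T => rfl
  have hf₃inj : Function.Injective f₃ := by
    intro T T' h
    have h' : LC₂ (T : Module.End ℂ (ℂ ⊗[ℚ] U)) = LC₂ (T' : Module.End ℂ (ℂ ⊗[ℚ] U)) := by
      rw [← hf₃apply, ← hf₃apply, h]
    apply Subtype.ext
    have h0 := h𝔞₃'injC _ (Submodule.sub_mem _ T.2 T'.2) (by rw [map_sub, h', sub_self])
    exact sub_eq_zero.1 h0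
  have hf₃surj : Function.Surjective f₃ := by
    rintro ⟨Y, hY⟩
    have hY' : Y ∈ spanC (𝔞₃'.map cL₂) := by rw [h𝔞₃'map, ← h𝔥C]; exact hY
    obtain ⟨T, hT, hTY⟩ := exists_mem_spanC_map_eq cL₂ LC₂ hLC₂c 𝔞₃' hY'
    exact ⟨⟨T, hT⟩, Subtype.ext (by rw [hf₃apply]; exact hTY)⟩
  obtain ⟨eqv, heqv⟩ : ∃ e : ↥(spanC 𝔞₃') ≃ₗ[ℂ] ↥(H₂.hodgeLieC), ∀ T, (e T : Module.End ℂ (ℂ ⊗[ℚ] V₂)) = LC₂ T :=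
    ⟨LinearEquiv.ofBijective f₃ ⟨hf₃inj, hf₃surj⟩, fun T => rfl⟩
  obtain ⟨K𝔥, hK𝔥⟩ := Submodule.exists_isCompl (H₂.hodgeLieC)
  obtain ⟨ρ, hρdef⟩ : ∃ ρ : Module.End ℂ (ℂ ⊗[ℚ] V₂) →ₗ[ℂ] Module.End ℂ (ℂ ⊗[ℚ] V₁),
      ∀ Y, ρ Y = LC₁ ((eqv.symm (Submodule.projectionOnto (H₂.hodgeLieC) K𝔥 hK𝔥 Y) : ↥(spanC 𝔞₃')) :
        Module.End ℂ (ℂ ⊗[ℚ] U)) :=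
    ⟨LC₁ ∘ₗ (spanC 𝔞₃').subtype ∘ₗ eqv.symm.toLinearMap ∘ₗ Submodule.projectionOnto (H₂.hodgeLieC) K𝔥 hK𝔥,
      fun Y => rfl⟩
  have hρ : ∀ Y ∈ H₂.hodgeLieC, ∃ T ∈ spanC 𝔞₃', LC₂ T = Y ∧ ρ Y = LC₁ T := by
    intro Y hY
    refine ⟨(eqv.symm ⟨Y, hY⟩ : ↥(spanC 𝔞₃')), (eqv.symm ⟨Y, hY⟩).2, ?_, ?_⟩
    · rw [← heqv, LinearEquiv.apply_symm_apply]
    · rw [hρdef, Submodule.projectionOnto_apply_of_mem_left hK𝔥 hY]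
  have hρT : ∀ T ∈ spanC 𝔞₃', ρ (LC₂ T) = LC₁ T := by
    intro T hT
    obtain ⟨T', hT', hT'Y, hρY⟩ := hρ (LC₂ T) (hLC₂memC T hT)
    have hTT' : T' = T := by
      have h := h𝔞₃'injC (T' - T) (Submodule.sub_mem _ hT' hT) (by rw [map_sub, hT'Y, sub_self])
      exact sub_eq_zero.1 h
    rw [hρY, hTT']
  -- elements of `(𝔞₃)_ℂ` with second corner in `𝔥_ℂ` lie in `(𝔞₃')_ℂ`
  have hlift : ∀ T ∈ spanC 𝔞₃, LC₂ T ∈ H₂.hodgeLieC → T ∈ spanC 𝔞₃' := by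
    intro T hT hTh
    obtain ⟨T', hT', hT'Y, -⟩ := hρ (LC₂ T) hTh
    have hTT' : T' = T := by
      have h := h𝔞₃injC (T' - T) (Submodule.sub_mem _ (spanC_mono h𝔞₃'le hT') hT) (by rw [map_sub, hT'Y, sub_self])
      exact sub_eq_zero.1 h
    rw [← hTT']
    exact hT'
  -- `ρ` preserves brackets on `𝔥_ℂ` and transports `ad Θ₂` to `ad Θ₁`
  have hρbr : ∀ Y ∈ H₂.hodgeLieC, ∀ Y' ∈ H₂.hodgeLieC, ρ (Y * Y' - Y' * Y) = ρ Y * ρ Y' - ρ Y' * ρ Y := by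
    intro Y hY Y' hY'
    obtain ⟨T, hT, rfl, hρY⟩ := hρ Y hY
    obtain ⟨T', hT', rfl, hρY'⟩ := hρ Y' hY'
    have hTT' : T * T' - T' * T ∈ spanC 𝔞₃' := bracket_mem_spanC_of_forall hbr𝔞₃' hT hT'
    rw [hρY, hρY', ← hLC₂mul T T' (h𝔞₃'leC hT'), ← hLC₂mul T' T (h𝔞₃'leC hT), ← map_sub, hρT _ hTT', map_sub,
      hLC₁mul T T' (h𝔞₃'leC hT'), hLC₁mul T' T (h𝔞₃'leC hT)]
  have hρΘ : ∀ Y ∈ H₂.hodgeLieC, ρ (Θ₂ * Y - Y * Θ₂) = Θ₁ * ρ Y - ρ Y * Θ₁ := by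
    intro Y hY
    obtain ⟨T, hT, rfl, hρY⟩ := hρ Y hY
    have hbrT : ΘU * T - T * ΘU ∈ spanC 𝔞₃ :=
      bracket_mem_spanC_of_forall h𝔞₃ideal hΘU𝔞 (spanC_mono h𝔞₃'le hT)
    have hbrT₂ : LC₂ (ΘU * T - T * ΘU) = Θ₂ * LC₂ T - LC₂ T * Θ₂ := by
      rw [map_sub, hLC₂mul ΘU T (h𝔞₃'leC hT), hLC₂mul T ΘU hΘU𝔞, hΘ₂eq]
    have hbrT' : ΘU * T - T * ΘU ∈ spanC 𝔞₃' := hlift _ hbrT (by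
      rw [hbrT₂]; exact H₂.commutator_mem_hodgeLieC hΘ₂C (hLC₂memC T hT))
    rw [hρY, ← hbrT₂, hρT _ hbrT', map_sub, hLC₁mul ΘU T (h𝔞₃'leC hT), hLC₁mul T ΘU hΘU𝔞, hΘ₁eq]
  -- THE BLOCKS `T_k` of `V₂ ⊗ ℂ`: forms, gradings, projections, extension operators
  obtain ⟨hPmem₂, hQmem₂, hΘ10, hΘ01, -⟩ := UnitaryTheta.theta_facts H₂ hn heff₂ hΘ₂
  have hodd : Odd n := by rw [hn]; exact odd_one
  set ω := ψ₂.form.baseChange ℂ with hω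
  have hωalt : ∀ x y, ω x y = -ω y x := fun x y => form_baseChange_swap_of_odd H₂ hodd ψ₂ y x
  have hΘskew : ∀ x y, ω (Θ₂ x) y + ω x (Θ₂ y) = 0 := fun x y => by
    rw [hω, formBaseChange_skew_of_mem_hodgeLieC ψ₂ hΘ₂C x y, neg_add_cancel]
  set Tb : κ → Submodule ℂ (ℂ ⊗[ℚ] V₂) := fun k => H₂.eigenBlock (τ k) with hTb
  have hYT : ∀ Y ∈ H₂.hodgeLieC, ∀ k, ∀ x ∈ Tb k, Y x ∈ Tb k := fun Y hY k x hx =>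
    H₂.apply_mem_eigenBlock_of_mem_hodgeLieC hY hx
  have horth : ∀ j k, j ≠ k → ∀ x ∈ Tb k, ∀ y ∈ Tb j, ω x y = 0 := by
    intro j k hjk x hx y hy
    by_cases hστ : τ k = τ j
    · have hdis : Disjoint (Tb k) (Tb j) := hint.submodule_iSupIndep.pairwiseDisjoint hjk.symm
      have hxx : x ∈ Tb k ⊓ Tb j := ⟨hx, by change x ∈ H₂.eigenBlock (τ j); rw [← hστ]; exact hx⟩
      rw [hdis.eq_bot, Submodule.mem_bot] at hxx
      rw [hxx, map_zero, LinearMap.zero_apply]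
    · exact form_eq_zero_of_mem_eigenBlock_of_isAdjointPair H₂ ψ₂ hself₂ hστ hx hy
  obtain ⟨pr, hpr1, hpr2, hpr3, hpr4⟩ := Blocks.exists_proj Tb hint
  -- restricted data on a block
  set ωb : ∀ k, LinearMap.BilinForm ℂ ↥(Tb k) := fun k => ω.compl₁₂ (Tb k).subtype (Tb k).subtype with hωb
  have hωb_apply : ∀ k (x y : Tb k), ωb k x y = ω (x : ℂ ⊗[ℚ] V₂) y := fun k x y => rfl
  have hωbnd : ∀ k, (ωb k).Nondegenerate := by
    intro k
    have hsepL : ∀ x : Tb k, (∀ y : Tb k, ωb k x y = 0) → x = 0 := fun x hx =>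
      Subtype.ext (SymplecticBlocks.eq_zero_of_forall_block H₂ ψ₂ hself₂ τ hint k x.2 fun y hy => hx ⟨y, hy⟩)
    exact ⟨fun x hx => hsepL x hx, fun y hy => hsepL y fun x => by rw [hωb_apply, hωalt, ← hωb_apply, hy x, neg_zero]⟩
  have hωbalt : ∀ k (x y : Tb k), ωb k x y = -ωb k y x := fun k x y => by rw [hωb_apply, hωb_apply, hωalt]
  set TΘ : ∀ k, Module.End ℂ ↥(Tb k) := fun k => Θ₂.restrict fun x hx => hYT Θ₂ hΘ₂C k x hx with hTΘ
  have hTΘ_coe : ∀ k (x : Tb k), ((TΘ k x : Tb k) : ℂ ⊗[ℚ] V₂) = Θ₂ x := fun k x => rfl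
  have hTT : ∀ k (v : Tb k), TΘ k (TΘ k v) = v := fun k v => Subtype.ext (by rw [hTΘ_coe, hTΘ_coe, hΘΘ₂])
  have hTskew : ∀ k (x y : Tb k), ωb k (TΘ k x) y + ωb k x (TΘ k y) = 0 := fun k x y => by
    rw [hωb_apply, hωb_apply, hTΘ_coe, hTΘ_coe]; exact hΘskew _ _
  set Pb : ∀ k, Submodule ℂ ↥(Tb k) := fun k => (H₂.piece 1 0).comap (Tb k).subtype with hPb
  set Qb : ∀ k, Submodule ℂ ↥(Tb k) := fun k => (H₂.piece 0 1).comap (Tb k).subtype with hQb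
  have hP : ∀ k, ∀ x ∈ Pb k, TΘ k x = x := fun k x hx => Subtype.ext (by rw [hTΘ_coe]; exact hΘ10 _ hx)
  have hQ : ∀ k, ∀ x ∈ Qb k, TΘ k x = -x := fun k x hx =>
    Subtype.ext (by rw [hTΘ_coe, Submodule.coe_neg]; exact hΘ01 _ hx)
  have hPmem : ∀ k (v : Tb k), (2 : ℂ)⁻¹ • (v + TΘ k v) ∈ Pb k := fun k v => by
    change (((2 : ℂ)⁻¹ • (v + TΘ k v) : Tb k) : ℂ ⊗[ℚ] V₂) ∈ H₂.piece 1 0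
    rw [Submodule.coe_smul, Submodule.coe_add, hTΘ_coe]
    exact hPmem₂ _
  have hQmem : ∀ k (v : Tb k), (2 : ℂ)⁻¹ • (v - TΘ k v) ∈ Qb k := fun k v => by
    change (((2 : ℂ)⁻¹ • (v - TΘ k v) : Tb k) : ℂ ⊗[ℚ] V₂) ∈ H₂.piece 0 1
    rw [Submodule.coe_smul, Submodule.coe_sub, hTΘ_coe]
    exact hQmem₂ _
  -- the skew operators of a block
  have h𝔰b : ∀ k, ∃ 𝔰 : Submodule ℂ (Module.End ℂ ↥(Tb k)), ∀ g, g ∈ 𝔰 ↔ ∀ x y, ωb k (g x) y + ωb k x (g y) = 0 := by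
    intro k
    exact
      ⟨{ carrier := {g | ∀ x y, ωb k (g x) y + ωb k x (g y) = 0}
         zero_mem' := fun x y => by simp
         add_mem' := fun {g g'} hg hg' x y => by
           simp only [LinearMap.add_apply, map_add]
           linear_combination hg x y + hg' x y
         smul_mem' := fun c g hg x y => by
           simp only [LinearMap.smul_apply, map_smul, smul_eq_mul]
           linear_combination c * hg x y }, fun g => Iff.rfl⟩
  choose 𝔰b h𝔰b using h𝔰b
  -- the extension `ext_k g = sub_k ∘ g ∘ p_k` of a block operator to `V₂ ⊗ ℂ`
  have hext : ∀ k, ∃ L : Module.End ℂ ↥(Tb k) →ₗ[ℂ] Module.End ℂ (ℂ ⊗[ℚ] V₂), ∀ g, L g = (Tb k).subtype ∘ₗ g ∘ₗ pr k := by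
    intro k
    exact
      ⟨{ toFun := fun g => (Tb k).subtype ∘ₗ g ∘ₗ pr k
         map_add' := fun g g' => by rw [LinearMap.add_comp, LinearMap.comp_add]
         map_smul' := fun c g => by rw [LinearMap.smul_comp, LinearMap.comp_smul, RingHom.id_apply] }, fun g => rfl⟩
  choose ext hext using hext
  have hext_apply : ∀ k g x, ext k g x = ((g (pr k x) : Tb k) : ℂ ⊗[ℚ] V₂) := fun k g x => by
    rw [hext]; rfl
  have hext_mem : ∀ k g (x : Tb k), ext k g x = ((g x : Tb k) : ℂ ⊗[ℚ] V₂) := fun k g x => by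
    rw [hext_apply, hpr1]
  have hext_zero : ∀ k j, j ≠ k → ∀ g, ∀ x ∈ Tb j, ext k g x = 0 := fun k j hjk g x hx => by
    rw [hext_apply, hpr2 k j hjk x hx, map_zero, Submodule.coe_zero]
  have hext_mapsTo : ∀ k g j, Set.MapsTo (ext k g) (Tb j) (Tb j) := by
    intro k g j x hx
    by_cases hjk : j = k
    · rw [hjk] at hx ⊢
      change ext k g x ∈ Tb k
      rw [hext_mem k g ⟨x, hx⟩]
      exact (g ⟨x, hx⟩).2
    · change ext k g x ∈ Tb j
      rw [hext_zero k j hjk g x hx]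
      exact (Tb j).zero_mem
  -- orthogonality of `T_k` to the value of a vector minus its `k`-th component
  have horth' : ∀ k (t : Tb k) (y : ℂ ⊗[ℚ] V₂), ω (t : ℂ ⊗[ℚ] V₂) y = ω (t : ℂ ⊗[ℚ] V₂) (pr k y : Tb k) := by
    intro k t y
    conv_lhs => rw [← hpr3 y]
    rw [map_sum, Finset.sum_eq_single k]
    · intro j _ hjk
      exact horth j k hjk _ t.2 _ (pr j y).2
    · intro hk; exact absurd (Finset.mem_univ k) hk
  have horth'' : ∀ k (x : ℂ ⊗[ℚ] V₂) (t : Tb k), ω x (t : ℂ ⊗[ℚ] V₂) = ω (pr k x : Tb k) (t : ℂ ⊗[ℚ] V₂) := by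
    intro k x t
    rw [hωalt, horth' k t x, hωalt, neg_neg]
  have hext_skew : ∀ k, ∀ g ∈ 𝔰b k, ∀ x y, ω (ext k g x) y + ω x (ext k g y) = 0 := by
    intro k g hg x y
    rw [hext_apply, hext_apply, horth' k (g (pr k x)) y, horth'' k x (g (pr k y)), ← hωb_apply, ← hωb_apply]
    exact (h𝔰b k g).1 hg _ _
  have hext𝔥 : ∀ k, ∀ g ∈ 𝔰b k, ext k g ∈ H₂.hodgeLieC := fun k g hg =>
    hrigid _ (hext_mapsTo k g) (hext_skew k g hg)
  have hext_mul : ∀ k g g', ext k g * ext k g' = ext k (g * g') := by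
    intro k g g'
    apply LinearMap.ext
    intro x
    rw [Module.End.mul_apply, hext_apply, hext_apply, hext_apply, Module.End.mul_apply, hpr1]
  have hext_mul_ne : ∀ k j, j ≠ k → ∀ g g', ext k g * ext j g' = 0 := by
    intro k j hjk g g'
    apply LinearMap.ext
    intro x
    rw [Module.End.mul_apply, hext_apply j g' x, hext_zero k j hjk g _ (g' (pr j x)).2, LinearMap.zero_apply]
  have hext_TΘ : ∀ k g, ext k (TΘ k * g - g * TΘ k) = Θ₂ * ext k g - ext k g * Θ₂ := by
    intro k g
    have hprΘ : ∀ x, TΘ k (pr k x) = pr k (Θ₂ x) := fun x =>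
      Subtype.ext (by rw [hTΘ_coe, hpr4 Θ₂ (fun j y hy => hYT Θ₂ hΘ₂C j y hy)])
    apply LinearMap.ext
    intro x
    simp only [LinearMap.sub_apply, Module.End.mul_apply, hext_apply, Submodule.coe_sub, hTΘ_coe, hprΘ]
  -- restriction of a block-preserving operator and its block decomposition
  have hrestr : ∀ Y : Module.End ℂ (ℂ ⊗[ℚ] V₂), ∀ hYm : ∀ k, Set.MapsTo Y (Tb k) (Tb k),
      Y = ∑ k, ext k (Y.restrict fun x hx => hYm k hx) := by
    intro Y hYm
    apply LinearMap.ext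
    intro x
    rw [LinearMap.sum_apply]
    conv_lhs => rw [← hpr3 x, map_sum]
    refine Finset.sum_congr rfl fun k _ => ?_
    rw [hext_apply, LinearMap.coe_restrict_apply]
  have hrestr_skew : ∀ Y (hY : Y ∈ H₂.hodgeLieC) (k : κ),
      Y.restrict (fun x hx => hYT Y hY k x hx) ∈ 𝔰b k := by
    intro Y hY k
    rw [h𝔰b]
    intro x y
    rw [hωb_apply, hωb_apply, LinearMap.coe_restrict_apply, LinearMap.coe_restrict_apply, hω,
      formBaseChange_skew_of_mem_hodgeLieC ψ₂ hY, neg_add_cancel]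
  -- `ρ_k = ρ ∘ ext_k` on a block: brackets and `ad Θ`
  have hρbrk : ∀ k, ∀ g ∈ 𝔰b k, ∀ g' ∈ 𝔰b k,
      (ρ ∘ₗ ext k) (g * g' - g' * g) = (ρ ∘ₗ ext k) g * (ρ ∘ₗ ext k) g' - (ρ ∘ₗ ext k) g' * (ρ ∘ₗ ext k) g := by
    intro k g hg g' hg'
    simp only [LinearMap.comp_apply]
    have h1 : ext k (g * g' - g' * g) = ext k g * ext k g' - ext k g' * ext k g := by
      rw [hext_mul, hext_mul]; exact map_sub (ext k) _ _
    rw [h1, hρbr _ (hext𝔥 k g hg) _ (hext𝔥 k g' hg')]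
  have hρΘk : ∀ k, ∀ g ∈ 𝔰b k, (ρ ∘ₗ ext k) (TΘ k * g - g * TΘ k) = Θ₁ * (ρ ∘ₗ ext k) g - (ρ ∘ₗ ext k) g * Θ₁ := by
    intro k g hg
    simp only [LinearMap.comp_apply]
    rw [hext_TΘ, hρΘ _ (hext𝔥 k g hg)]
  have hρcomm : ∀ k j, j ≠ k → ∀ g ∈ 𝔰b k, ∀ g' ∈ 𝔰b j, ρ (ext k g) * ρ (ext j g') = ρ (ext j g') * ρ (ext k g) := by
    intro k j hjk g hg g' hg'
    have h := hρbr _ (hext𝔥 k g hg) _ (hext𝔥 j g' hg')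
    rw [hext_mul_ne k j hjk, hext_mul_ne j k (Ne.symm hjk), sub_self, map_zero] at h
    exact (sub_eq_zero.1 h.symm)
  -- THE CLAIM: `ρ` kills every `𝔰𝔭(T_k)`
  have hclaim : ∀ k, ∀ g ∈ 𝔰b k, ρ (ext k g) = 0 := by
    intro k
    -- the empty block
    by_cases hTk : Tb k = ⊥
    · intro g _
      haveI : Subsingleton ↥(Tb k) := by
        refine ⟨fun x y => Subtype.ext ?_⟩
        have hx : (x : ℂ ⊗[ℚ] V₂) ∈ (⊥ : Submodule ℂ (ℂ ⊗[ℚ] V₂)) := hTk ▸ x.2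
        have hy : (y : ℂ ⊗[ℚ] V₂) ∈ (⊥ : Submodule ℂ (ℂ ⊗[ℚ] V₂)) := hTk ▸ y.2
        rw [(Submodule.mem_bot ℂ).1 hx, (Submodule.mem_bot ℂ).1 hy]
      have hg0 : g = 0 := Subsingleton.elim _ _
      rw [hg0, map_zero, map_zero]
    haveI : Nontrivial ↥(Tb k) := (Submodule.nontrivial_iff_ne_bot).2 hTk
    have hP0 : Pb k ≠ ⊥ := SymplecticWitness.P_ne_bot_of_nontrivial (ωb k) (hωbnd k) (hTskew k) (hPmem k)
    -- dichotomy: `ρ_k` injective on `𝔰𝔭(T_k)`, or zero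
    by_cases hinj : ∀ g ∈ 𝔰b k, (ρ ∘ₗ ext k) g = 0 → g = 0
    swap
    · -- the kernel is a non-zero ideal, contains `Θ|_{T_k}`, hence is everything (§0)
      push Not at hinj
      obtain ⟨g₀, hg₀, hρg₀, hg₀0⟩ := hinj
      let I : Submodule ℂ (Module.End ℂ ↥(Tb k)) :=
        { carrier := {g | g ∈ 𝔰b k ∧ (ρ ∘ₗ ext k) g = 0}
          zero_mem' := ⟨(𝔰b k).zero_mem, by rw [map_zero]⟩
          add_mem' := fun {g g'} hg hg' => ⟨(𝔰b k).add_mem hg.1 hg'.1, by rw [map_add, hg.2, hg'.2, add_zero]⟩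
          smul_mem' := fun c g hg => ⟨(𝔰b k).smul_mem c hg.1, by rw [map_smul, hg.2, smul_zero]⟩ }
      have hImem : ∀ g, g ∈ I ↔ g ∈ 𝔰b k ∧ (ρ ∘ₗ ext k) g = 0 := fun g => Iff.rfl
      have hIskew : ∀ g ∈ I, ∀ x y, ωb k (g x) y + ωb k x (g y) = 0 := fun g hg => (h𝔰b k g).1 hg.1
      have hI : ∀ Z : Module.End ℂ ↥(Tb k), (∀ x y, ωb k (Z x) y + ωb k x (Z y) = 0) → ∀ g ∈ I, Z * g - g * Z ∈ I := by
        intro Z hZ g hg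
        have hZ' : Z ∈ 𝔰b k := (h𝔰b k Z).2 hZ
        refine ⟨?_, ?_⟩
        · rw [h𝔰b]
          intro x y
          simp only [LinearMap.sub_apply, Module.End.mul_apply, map_sub, LinearMap.sub_apply]
          have e1 := hZ (g x) y
          have e2 := (h𝔰b k g).1 hg.1 x (Z y)
          have e3 := (h𝔰b k g).1 hg.1 (Z x) y
          have e4 := hZ x (g y)
          linear_combination e1 - e3 + e4 - e2
        · simp only [hρbrk k Z hZ' g hg.1, hg.2, mul_zero, zero_mul, sub_self]
      have hI0 : I ≠ ⊥ := by
        intro h0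
        have : g₀ ∈ I := ⟨hg₀, hρg₀⟩
        rw [h0, Submodule.mem_bot] at this
        exact hg₀0 this
      have hΘI : TΘ k ∈ I := SymplecticIdeal.theta_mem_of_ne_bot (ωb k) (hωbnd k) (hωbalt k) (hTT k) (hTskew k)
        (hP k) (hQ k) (hPmem k) (hQmem k) I hIskew hI hI0
      intro g hg
      have h := SymplecticWitness.eq_zero_of_theta_bracket_of_bracket (ωb k) (hωbnd k) (hωbalt k) (hTT k) (hTskew k)
        (hP k) (hQ k) (hPmem k) (hQmem k) (ρ ∘ₗ ext k)
        (fun Y hY => by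
          simp only [hρbrk k (TΘ k) hΘI.1 Y ((h𝔰b k Y).2 hY), hΘI.2, zero_mul, mul_zero, sub_self])
        (fun Y Y' hY hY' h0 h0' => by
          simp only [hρbrk k Y ((h𝔰b k Y).2 hY) Y' ((h𝔰b k Y').2 hY'), h0, h0', zero_mul, sub_self])
        ((h𝔰b k g).1 hg)
      simpa only [LinearMap.comp_apply] using h
    -- THE GRAPH CASE: `ρ_k` injective; the standard representation of `𝔰𝔭(T_k)` occurs in `V₁ ⊗ ℂ`
    exfalso
    obtain ⟨F, hFne, hFeq⟩ := SymplecticWitness.exists_equivariant_ne_zero (ωb k) (hωbnd k) (hωbalt k) (hTT k)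
      (hTskew k) (hP k) (hQ k) (hPmem k) (hQmem k) hP0 (𝔰b k) (h𝔰b k) hΘΘ₁ (ρ ∘ₗ ext k) (hρbrk k) (hρΘk k) hinj
    have hFapply : ∀ g ∈ 𝔰b k, ∀ v, ρ (ext k g) (F v) = F (g v) := fun g hg v => by
      have h := LinearMap.congr_fun (hFeq g hg) v
      simpa only [LinearMap.comp_apply] using h
    have hΘF : Θ₁ ∘ₗ F = F ∘ₗ TΘ k := SymplecticWitness.theta_comp_eq_of_equivariant (ωb k) (hωbnd k) (hωbalt k)
      (hTskew k) (hP k) (hQ k) (hPmem k) (hQmem k) (𝔰b k) (h𝔰b k) hΘΘ₁ (ρ ∘ₗ ext k) (hρΘk k) F hFeq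
    -- the other blocks act trivially on `F` (the `Θ`-weights, §0)
    have hother : ∀ j, j ≠ k → ∀ g ∈ 𝔰b j, ρ (ext j g) ∘ₗ F = 0 := by
      intro j hjk
      obtain ⟨σL, hσL⟩ : ∃ L : Module.End ℂ ↥(Tb j) →ₗ[ℂ] (↥(Tb k) →ₗ[ℂ] ℂ ⊗[ℚ] V₁), ∀ g, L g = ρ (ext j g) ∘ₗ F :=
        ⟨{ toFun := fun g => ρ (ext j g) ∘ₗ F
           map_add' := fun g g' => by rw [map_add, map_add, LinearMap.add_comp]
           map_smul' := fun c g => by rw [map_smul, map_smul, LinearMap.smul_comp, RingHom.id_apply] }, fun g => rfl⟩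
      intro g hg
      rw [← hσL]
      refine SymplecticWitness.eq_zero_of_theta_bracket_of_bracket (ωb j) (hωbnd j) (hωbalt j) (hTT j) (hTskew j)
        (hP j) (hQ j) (hPmem j) (hQmem j) σL (fun Y hY => ?_) (fun Y Y' hY hY' h0 h0' => ?_) ((h𝔰b j g).1 hg)
      · -- `σ[Θ_j, Y] = Θ₁ G - G Θ_k = 0` for the `ρ_k`-equivariant `G = ρ(ext_j Y) F`
        have hY' : Y ∈ 𝔰b j := (h𝔰b j Y).2 hY
        have hGeq : ∀ g' ∈ 𝔰b k, (ρ ∘ₗ ext k) g' ∘ₗ (ρ (ext j Y) ∘ₗ F) = (ρ (ext j Y) ∘ₗ F) ∘ₗ g' := by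
          intro g' hg'
          rw [LinearMap.comp_apply, ← LinearMap.comp_assoc, ← Module.End.mul_eq_comp, hρcomm k j hjk g' hg' Y hY',
            Module.End.mul_eq_comp, LinearMap.comp_assoc, ← LinearMap.comp_apply (f := ρ) (g := ext k), hFeq g' hg',
            LinearMap.comp_assoc]
        have hΘG := SymplecticWitness.theta_comp_eq_of_equivariant (ωb k) (hωbnd k) (hωbalt k) (hTskew k) (hP k) (hQ k)
          (hPmem k) (hQmem k) (𝔰b k) (h𝔰b k) hΘΘ₁ (ρ ∘ₗ ext k) (hρΘk k) _ hGeq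
        rw [hσL, ← LinearMap.comp_apply (f := ρ) (g := ext j), hρΘk j Y hY', LinearMap.comp_apply, LinearMap.sub_comp,
          Module.End.mul_eq_comp, Module.End.mul_eq_comp, LinearMap.comp_assoc F (ρ (ext j Y)) Θ₁,
          LinearMap.comp_assoc F Θ₁ (ρ (ext j Y)), hΘF, ← LinearMap.comp_assoc (TΘ k) F (ρ (ext j Y)), hΘG, sub_self]
      · rw [hσL, ← LinearMap.comp_apply (f := ρ) (g := ext j), hρbrk j Y ((h𝔰b j Y).2 hY) Y' ((h𝔰b j Y').2 hY'),
          LinearMap.comp_apply, LinearMap.comp_apply, LinearMap.sub_comp, Module.End.mul_eq_comp, Module.End.mul_eq_comp,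
          LinearMap.comp_assoc F (ρ (ext j Y')) (ρ (ext j Y)), LinearMap.comp_assoc F (ρ (ext j Y)) (ρ (ext j Y'))]
        rw [hσL] at h0 h0'
        rw [h0, h0', LinearMap.comp_zero, LinearMap.comp_zero, sub_self]
    -- `Z' = ι₁ F p_k π₂` commutes with `(𝔞₃')_ℂ`
    obtain ⟨Fm, hFm⟩ : ∃ Fm : ℂ ⊗[ℚ] V₂ →ₗ[ℂ] ℂ ⊗[ℚ] V₁, Fm = F ∘ₗ pr k := ⟨_, rfl⟩
    obtain ⟨Z', hZ'⟩ : ∃ Z' : Module.End ℂ (ℂ ⊗[ℚ] U), Z' = ι₁.baseChange ℂ ∘ₗ Fm ∘ₗ π₂.baseChange ℂ :=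
      ⟨_, rfl⟩
    have hcommZ' : ∀ T ∈ spanC 𝔞, LC₁ T ∘ₗ Fm = Fm ∘ₗ LC₂ T → T * Z' = Z' * T := by
      intro T hT hTF
      apply LinearMap.ext
      intro y
      rw [Module.End.mul_apply, Module.End.mul_apply, hZ', LinearMap.comp_apply, LinearMap.comp_apply,
        happlyι₁ T hT, LinearMap.comp_apply, LinearMap.comp_apply, hprojT₂ T hT, ← LinearMap.comp_apply (f := LC₁ T),
        hTF, LinearMap.comp_apply]
    have hρFm : ∀ Y ∈ H₂.hodgeLieC, ρ Y ∘ₗ Fm = Fm ∘ₗ Y := by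
      intro Y hY
      have hYm : ∀ j, Set.MapsTo Y (Tb j) (Tb j) := fun j x hx => hYT Y hY j x hx
      have hdec := hrestr Y hYm
      apply LinearMap.ext
      intro x
      rw [LinearMap.comp_apply, LinearMap.comp_apply, hFm, LinearMap.comp_apply, LinearMap.comp_apply]
      conv_lhs => rw [hdec, map_sum, LinearMap.sum_apply]
      rw [Finset.sum_eq_single k]
      · rw [hFapply _ (hrestr_skew Y hY k)]
        congr 1
        apply Subtype.ext
        rw [LinearMap.coe_restrict_apply, hpr4 Y hYm]
      · intro j _ hjk
        rw [← LinearMap.comp_apply, hother j hjk _ (hrestr_skew Y hY j), LinearMap.zero_apply]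
      · intro hk; exact absurd (Finset.mem_univ k) hk
    have hcomm₃ : ∀ T ∈ spanC 𝔞₃', T * Z' = Z' * T := by
      intro T hT
      refine hcommZ' T (h𝔞₃'leC hT) ?_
      rw [← hρT T hT]
      exact hρFm _ (hLC₂memC T hT)
    -- descent: `Z'` lies in the complex span of the RATIONAL operators commuting with `𝔞₃'` ...
    have hZ'span := mem_span_baseChange_of_forall_commute (𝔞₃' : Set (Module.End ℚ U)) (Y := Z')
      (fun X hX => (hcomm₃ _ (baseChange_mem_spanC hX)).symm)
    -- ... whose `(1,2)`-blocks vanish by `Hom = 0`: they are `ρ`-equivariant on `𝔥_ℂ`, hence intertwine `Θ₂`, `Θ₁`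
    have hblock : ∀ Z : Module.End ℚ U, (∀ X ∈ (𝔞₃' : Set (Module.End ℚ U)), Z * X = X * Z) →
        π₁ ∘ₗ Z ∘ₗ ι₂ = 0 := by
      intro Z hZ
      have hZC : ∀ T ∈ spanC 𝔞₃', T * Z.baseChange ℂ = Z.baseChange ℂ * T := fun T hT =>
        (commute_of_mem_spanC (𝔤 := 𝔞₃') (T := Z.baseChange ℂ) (fun X hX => by
          rw [← LinearMap.baseChange_mul, hZ X hX, LinearMap.baseChange_mul]) hT).symm
      set f := (π₁ ∘ₗ Z ∘ₗ ι₂).baseChange ℂ with hf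
      have hfT : ∀ T ∈ spanC 𝔞₃', ∀ x, f (LC₂ T x) = LC₁ T (f x) := by
        intro T hT x
        have hT𝔞 : T ∈ spanC 𝔞 := h𝔞₃'leC hT
        rw [hf, LinearMap.baseChange_comp, LinearMap.baseChange_comp, LinearMap.comp_apply, LinearMap.comp_apply,
          LinearMap.comp_apply, LinearMap.comp_apply, ← happlyι₂ T hT𝔞, ← Module.End.mul_apply (f := Z.baseChange ℂ),
          ← hZC T hT, Module.End.mul_apply, hprojT₁ T hT𝔞]
      have hfY : ∀ Y ∈ H₂.hodgeLieC, ∀ x, f (Y x) = ρ Y (f x) := by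
        intro Y hY x
        obtain ⟨T, hT, rfl, hρY⟩ := hρ Y hY
        rw [hρY, hfT T hT]
      -- block by block: `f|_{T_j}` is `ρ_j`-equivariant, hence intertwines the gradings
      have hΘf : ∀ j (x : Tb j), Θ₁ (f x) = f (Θ₂ x) := by
        intro j x
        have hfj : ∀ g ∈ 𝔰b j, (ρ ∘ₗ ext j) g ∘ₗ (f ∘ₗ (Tb j).subtype) = (f ∘ₗ (Tb j).subtype) ∘ₗ g := by
          intro g hg
          apply LinearMap.ext
          intro y
          rw [LinearMap.comp_apply, LinearMap.comp_apply, LinearMap.comp_apply, LinearMap.comp_apply,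
            LinearMap.comp_apply, Submodule.subtype_apply, Submodule.subtype_apply, ← hfY _ (hext𝔥 j g hg),
            hext_mem]
        have h := SymplecticWitness.theta_comp_eq_of_equivariant (ωb j) (hωbnd j) (hωbalt j) (hTskew j) (hP j) (hQ j)
          (hPmem j) (hQmem j) (𝔰b j) (h𝔰b j) hΘΘ₁ (ρ ∘ₗ ext j) (hρΘk j) _ hfj
        have h' := LinearMap.congr_fun h x
        simpa only [LinearMap.comp_apply, Submodule.subtype_apply, hTΘ_coe] using h'
      refine hHom _ (LinearMap.ext fun x => ?_)
      rw [LinearMap.comp_apply, LinearMap.comp_apply, ← hf]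
      conv_lhs => rw [← hpr3 x, map_sum, map_sum]
      conv_rhs => rw [← hpr3 x, map_sum, map_sum]
      exact Finset.sum_congr rfl fun j _ => hΘf j (pr j x)
    -- hence the `(1,2)`-block `Fm` of `Z'` vanishes: contradiction
    obtain ⟨Φ, hΦ⟩ : ∃ L : Module.End ℂ (ℂ ⊗[ℚ] U) →ₗ[ℂ] (ℂ ⊗[ℚ] V₂ →ₗ[ℂ] ℂ ⊗[ℚ] V₁),
        ∀ T, L T = π₁.baseChange ℂ ∘ₗ T ∘ₗ ι₂.baseChange ℂ :=
      ⟨{ toFun := fun T => π₁.baseChange ℂ ∘ₗ T ∘ₗ ι₂.baseChange ℂ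
         map_add' := fun T T' => by rw [LinearMap.add_comp, LinearMap.comp_add]
         map_smul' := fun c T => by rw [LinearMap.smul_comp, LinearMap.comp_smul, RingHom.id_apply] },
        fun T => rfl⟩
    have hΦspan : ∀ T ∈ Submodule.span ℂ ((fun Z : Module.End ℚ U => Z.baseChange ℂ) ''
        {Z | ∀ X ∈ (𝔞₃' : Set (Module.End ℚ U)), Z * X = X * Z}), Φ T = 0 := by
      intro T hT
      induction hT using Submodule.span_induction with
      | mem T' hT' =>
        obtain ⟨Z, hZ, rfl⟩ := hT'
        rw [hΦ, ← LinearMap.baseChange_comp, ← LinearMap.baseChange_comp, hblock Z hZ, LinearMap.baseChange_zero]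
      | zero => rw [map_zero]
      | add T' T'' _ _ h' h'' => rw [map_add, h', h'', add_zero]
      | smul c T' _ h' => rw [map_smul, h', smul_zero]
    have hFm0 : Fm = 0 := by
      have h := hΦspan Z' hZ'span
      rw [hΦ, hZ'] at h
      have h' : π₁.baseChange ℂ ∘ₗ (ι₁.baseChange ℂ ∘ₗ Fm ∘ₗ π₂.baseChange ℂ) ∘ₗ ι₂.baseChange ℂ = Fm := by
        apply LinearMap.ext
        intro x
        simp only [LinearMap.comp_apply, proj_incl_baseChange hπι₁, proj_incl_baseChange hπι₂]
      rw [h'] at h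
      exact h
    apply hFne
    apply LinearMap.ext
    intro v
    have h := LinearMap.congr_fun hFm0 (v : ℂ ⊗[ℚ] V₂)
    rw [hFm, LinearMap.comp_apply, hpr1, LinearMap.zero_apply] at h
    rw [h, LinearMap.zero_apply]
  -- `ρ` kills `𝔥_ℂ`
  have hρ0 : ∀ Y ∈ H₂.hodgeLieC, ρ Y = 0 := by
    intro Y hY
    have hYm : ∀ j, Set.MapsTo Y (Tb j) (Tb j) := fun j x hx => hYT Y hY j x hx
    rw [hrestr Y hYm, map_sum]
    exact Finset.sum_eq_zero fun k _ => hclaim k _ (hrestr_skew Y hY k)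
  -- conclusion: `Z₂ = c₂ X` with `X ∈ 𝔞₃'`, `c₁ X = 0`, so `ι₂ Z₂ π₂ = X ∈ 𝔞`
  intro Z₂ hZ₂
  obtain ⟨X, hX, hXZ⟩ := Submodule.mem_map.1 ((h𝔞₃'map.symm ▸ hZ₂ : Z₂ ∈ 𝔞₃'.map cL₂))
  have hX𝔞 : X ∈ 𝔞 := h𝔞₃'le𝔞 hX
  have hc₁X : cL₁ X = 0 := by
    have h1 : (cL₁ X).baseChange ℂ = 0 := by
      rw [← hLC₁c, ← hρT _ (baseChange_mem_spanC hX), hLC₂c, hXZ]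
      exact hρ0 _ (h𝔥C ▸ baseChange_mem_spanC hZ₂)
    have h2 : (cL₁ X).baseChange ℂ ∈ spanC (⊥ : Submodule ℚ (Module.End ℚ V₁)) := by
      rw [h1]; exact Submodule.zero_mem _
    exact (Submodule.mem_bot ℚ).1 (mem_of_baseChange_mem_spanC ⊥ h2)
  have hdec := eq_incl_corner_add hπι₁ hπι₂ hsum (hP₁ X hX𝔞) (hP₂ X hX𝔞)
  rw [hcL₁] at hc₁X
  rw [hcL₂] at hXZ
  rw [hc₁X, hXZ] at hdec
  simp only [LinearMap.zero_comp, LinearMap.comp_zero, zero_add] at hdec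
  rw [← hdec]
  exact hX𝔞

end Goursat

/-! ### §3 The annihilator algebra of a `Θ_U`-killed rational tensor on `V₁ ⊕ V₂`: `0 ⊕ hg(V₂) ⊆ 𝔞(q)` and
`Θ₁ ⊕ 0 ∈ 𝔞(q)_ℂ` -/

section Main

universe u

variable {U V₁ V₂ : Type u} [AddCommGroup U] [Module ℚ U] [AddCommGroup V₁] [Module ℚ V₁]
  [AddCommGroup V₂] [Module ℚ V₂] [Module.Finite ℚ U] [Module.Finite ℚ V₁] [Module.Finite ℚ V₂]
  [HodgeTensorFacts.{u, u}] {n : ℤ} {κ : Type} [Fintype κ] [DecidableEq κ]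
variable {M d m : ℕ}

omit [Module.Finite ℚ U] [Module.Finite ℚ V₁] [Module.Finite ℚ V₂] [HodgeTensorFacts.{u, u}] in
/-- Complexification of a sum of bilinear forms, evaluated (a copy of the private lemma of
`HodgeThetaAnnihilatorTimesRigidSymplectic`). [folklore] -/
private theorem baseChange_add_apply_rb (B B' : LinearMap.BilinForm ℚ U) (x y : ℂ ⊗[ℚ] U) :
    LinearMap.BilinForm.baseChange ℂ (B + B') x y =
      LinearMap.BilinForm.baseChange ℂ B x y + LinearMap.BilinForm.baseChange ℂ B' x y := by
  induction x using TensorProduct.induction_on with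
  | zero => simp
  | tmul c v =>
    induction y using TensorProduct.induction_on with
    | zero => simp
    | tmul d w =>
      simp only [LinearMap.BilinForm.baseChange_tmul, LinearMap.add_apply, add_smul]
    | add y y' hy hy' => rw [map_add, map_add, map_add, hy, hy']; abel
  | add x x' hx hx' =>
    rw [map_add, LinearMap.add_apply, map_add, map_add, LinearMap.add_apply, LinearMap.add_apply, hx, hx']
    abel

/-- **The core (Moonen–Zarhin Lemma (3.4) for a second factor with rigid symplectic blocks, Lie form, word model).**
For the annihilator algebra `𝔞 = annLie φ eQ aF q` of a rational tensor `q` on `U = ι₁V₁ ⊕ ι₂V₂` killed by `Θ_U`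
(`φ = ψ₁(π₁·,π₁·) + ψ₂(π₂·,π₂·)`; `aF` = the Hodge endomorphisms `ι₁ a π₁`, `a ∈ End_Hdg(V₁)`, and the two
projectors), where on `V₂` every Hodge endomorphism is `ψ₂`-self-adjoint, `V₂ ⊗ ℂ = ⊕ᵢ Tᵢ` is the internal sum of
the eigenblocks of a family of characters of `End_Hdg(V₂)` and (RIGID BLOCKS) every block-preserving `ψ₂ ⊗ ℂ`-skew
operator lies in `Lie Hg(H₂) ⊗ ℂ`, and where `Hom_Hdg(V₂, V₁) = 0`: `ι₂ Z π₂ ∈ 𝔞` for all `Z ∈ Lie Hg(H₂)` and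
`Θ_U ∈ 𝔞_ℂ` («either `Hg(X) = Hg(X₁) × Hg(X₂)` or `Hom(X₂, X₁) ≠ 0`»; Hazama: «Suppose `X₁` and `X₂` contain no
factors of Type 4. Then … either `Hom(X₁, X₂) ≠ 0` or `Hg(X₁ × X₂) = Hg(X₁) × Hg(X₂)`», here for `X₂` with
`hg(X₂) ⊗ ℂ` the full block-symplectic algebra).
[cite: MoonenZarhin1999LowDim, §3 (3.1), Thm. (3.2)(1) and Lemma (3.4)] [cite: Hazama1989, Thm. (= Gordon 7.6.2)]
[cite: Deligne1982HodgeCycles, I §3 (proof of Prop. 3.4)] -/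
theorem incl₂_mem_annLie_of_times_rigidBlocks (hn : n = 1) (HU : HodgeStructure U n)
    (H₁ : HodgeStructure V₁ n) (H₂ : HodgeStructure V₂ n) (heff₁ : H₁.IsEffective) (heff₂ : H₂.IsEffective)
    {ι₁ : V₁ →ₗ[ℚ] U} {π₁ : U →ₗ[ℚ] V₁} {ι₂ : V₂ →ₗ[ℚ] U} {π₂ : U →ₗ[ℚ] V₂}
    (hπι₁ : π₁ ∘ₗ ι₁ = LinearMap.id) (hπι₂ : π₂ ∘ₗ ι₂ = LinearMap.id) (hπ₁ι₂ : π₁ ∘ₗ ι₂ = 0)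
    (hπ₂ι₁ : π₂ ∘ₗ ι₁ = 0) (hsum : ι₁ ∘ₗ π₁ + ι₂ ∘ₗ π₂ = LinearMap.id)
    (hι₁F : ∀ p, ∀ x ∈ H₁.piece p (n - p), ι₁.baseChange ℂ x ∈ HU.piece p (n - p))
    (hι₂F : ∀ p, ∀ x ∈ H₂.piece p (n - p), ι₂.baseChange ℂ x ∈ HU.piece p (n - p))
    (ψ₁ : H₁.Polarization) (ψ₂ : H₂.Polarization)
    (hself₂ : ∀ a : H₂.endAlg, LinearMap.IsAdjointPair ψ₂.form ψ₂.form (a : Module.End ℚ V₂) (a : Module.End ℚ V₂))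
    (τ : κ → (H₂.endAlg →+* ℂ)) (hint : DirectSum.IsInternal fun k => H₂.eigenBlock (τ k))
    (hrigid : ∀ Y : Module.End ℂ (ℂ ⊗[ℚ] V₂), (∀ k, Set.MapsTo Y (H₂.eigenBlock (τ k)) (H₂.eigenBlock (τ k))) →
      (∀ x y, ψ₂.form.baseChange ℂ (Y x) y + ψ₂.form.baseChange ℂ x (Y y) = 0) → Y ∈ H₂.hodgeLieC)
    (hHom : ∀ f : V₂ →ₗ[ℚ] V₁,
      (∀ p, ∀ x ∈ H₂.piece p (n - p), f.baseChange ℂ x ∈ H₁.piece p (n - p)) → f = 0)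
    (eQ : Module.Basis (Fin M) ℚ U) (q : (Fin d → Fin m × Fin M) → ℚ)
    {ΘU : Module.End ℂ (ℂ ⊗[ℚ] U)} (hΘU : ∀ p, ∀ x ∈ HU.piece p (n - p), ΘU x = ((2 * p - n : ℤ) : ℂ) • x)
    (hΘq : ∀ u : Fin d → Fin m, wordDerAt ℂ (fun _ : Fin d =>
      LinearMap.toMatrix (Algebra.TensorProduct.basis ℂ eQ) (Algebra.TensorProduct.basis ℂ eQ) ΘU)
      (wordSlice (fun w => algebraMap ℚ ℂ (q w)) u) = 0) :
    (∀ Z₂ ∈ H₂.hodgeLie,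
      ι₂ ∘ₗ Z₂ ∘ₗ π₂ ∈ annLie (ψ₁.form.compl₁₂ π₁ π₁ + ψ₂.form.compl₁₂ π₂ π₂) eQ
        (Sum.elim (fun a : H₁.endAlg => ι₁ ∘ₗ (a : Module.End ℚ V₁) ∘ₗ π₁)
          (Sum.elim (fun _ : Unit => ι₁ ∘ₗ π₁) (fun _ : Unit => ι₂ ∘ₗ π₂))) q) ∧
    ΘU ∈ spanC (annLie (ψ₁.form.compl₁₂ π₁ π₁ + ψ₂.form.compl₁₂ π₂ π₂) eQ
        (Sum.elim (fun a : H₁.endAlg => ι₁ ∘ₗ (a : Module.End ℚ V₁) ∘ₗ π₁)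
          (Sum.elim (fun _ : Unit => ι₁ ∘ₗ π₁) (fun _ : Unit => ι₂ ∘ₗ π₂))) q) := by
  classical
  obtain ⟨Θ₁, hΘ₁⟩ := exists_hodgeTheta H₁
  obtain ⟨Θ₂, hΘ₂⟩ := exists_hodgeTheta H₂
  have hΘ₁C : Θ₁ ∈ H₁.hodgeLieC := H₁.mem_hodgeLieC_of_forall_piece hΘ₁
  have hΘ₂C : Θ₂ ∈ H₂.hodgeLieC := H₂.mem_hodgeLieC_of_forall_piece hΘ₂
  have hsum' : ι₂ ∘ₗ π₂ + ι₁ ∘ₗ π₁ = LinearMap.id := by rw [add_comm]; exact hsum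
  have e11 : ∀ v, π₁ (ι₁ v) = v := fun v => by
    rw [← LinearMap.comp_apply (f := π₁), hπι₁, LinearMap.id_apply]
  have e21 : ∀ v, π₂ (ι₁ v) = 0 := fun v => by
    rw [← LinearMap.comp_apply (f := π₂), hπ₂ι₁, LinearMap.zero_apply]
  -- `Θ` through the presentation
  have hΘι₁ := theta_incl_eq HU H₁ hι₁F hΘU hΘ₁
  have hΘι₂ := theta_incl_eq HU H₂ hι₂F hΘU hΘ₂
  have hΘπ₁ := proj_theta_eq HU H₁ H₂ hπι₁ hπ₁ι₂ hsum hι₁F hι₂F hΘU hΘ₁ hΘ₂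
  have hΘπ₂ := proj_theta_eq HU H₂ H₁ hπι₂ hπ₂ι₁ hsum' hι₂F hι₁F hΘU hΘ₂ hΘ₁
  -- the commuting family and the orthogonal-sum form
  set aF : H₁.endAlg ⊕ (Unit ⊕ Unit) → Module.End ℚ U :=
    Sum.elim (fun a : H₁.endAlg => ι₁ ∘ₗ (a : Module.End ℚ V₁) ∘ₗ π₁)
      (Sum.elim (fun _ : Unit => ι₁ ∘ₗ π₁) (fun _ : Unit => ι₂ ∘ₗ π₂)) with haF
  set φ : LinearMap.BilinForm ℚ U := ψ₁.form.compl₁₂ π₁ π₁ + ψ₂.form.compl₁₂ π₂ π₂ with hφ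
  have hφC : ∀ x y, φ.baseChange ℂ x y = ψ₁.form.baseChange ℂ (π₁.baseChange ℂ x) (π₁.baseChange ℂ y) +
      ψ₂.form.baseChange ℂ (π₂.baseChange ℂ x) (π₂.baseChange ℂ y) := fun x y => by
    rw [hφ, baseChange_add_apply_rb, baseChange_compl₁₂_apply, baseChange_compl₁₂_apply]
  have hφapply : ∀ x y, φ x y = ψ₁.form (π₁ x) (π₁ y) + ψ₂.form (π₂ x) (π₂ y) := fun x y => by
    rw [hφ, LinearMap.add_apply, LinearMap.add_apply, LinearMap.compl₁₂_apply, LinearMap.compl₁₂_apply]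
  set 𝔞 : Submodule ℚ (Module.End ℚ U) := annLie φ eQ aF q with h𝔞
  -- `Θ_U ∈ 𝔞_ℂ`
  have hΘ𝔞 : ΘU ∈ spanC 𝔞 := by
    refine mem_spanC_annLie φ eQ aF q hΘq (fun i => ?_) (fun x y => ?_)
    · apply LinearMap.ext
      intro y
      rcases i with a | (_ | _)
      · change ΘU ((ι₁ ∘ₗ (a : Module.End ℚ V₁) ∘ₗ π₁).baseChange ℂ y) =
          (ι₁ ∘ₗ (a : Module.End ℚ V₁) ∘ₗ π₁).baseChange ℂ (ΘU y)
        simp only [LinearMap.baseChange_comp, LinearMap.comp_apply]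
        rw [hΘι₁, ← Module.End.mul_apply (f := Θ₁), commute_baseChange_of_mem_hodgeLieC H₁ hΘ₁C a,
          Module.End.mul_apply, hΘπ₁]
      · change ΘU ((ι₁ ∘ₗ π₁).baseChange ℂ y) = (ι₁ ∘ₗ π₁).baseChange ℂ (ΘU y)
        simp only [LinearMap.baseChange_comp, LinearMap.comp_apply]
        rw [hΘι₁, hΘπ₁]
      · change ΘU ((ι₂ ∘ₗ π₂).baseChange ℂ y) = (ι₂ ∘ₗ π₂).baseChange ℂ (ΘU y)
        simp only [LinearMap.baseChange_comp, LinearMap.comp_apply]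
        rw [hΘι₂, hΘπ₂]
    · rw [hφC, hφC, hΘπ₁, hΘπ₁, hΘπ₂, hΘπ₂, formBaseChange_skew_of_mem_hodgeLieC ψ₁ hΘ₁C,
        formBaseChange_skew_of_mem_hodgeLieC ψ₂ hΘ₂C]
      ring
  -- what membership in `𝔞` gives
  have hbr𝔞 : ∀ X ∈ 𝔞, ∀ X' ∈ 𝔞, X * X' - X' * X ∈ 𝔞 := fun X hX X' hX' =>
    commutator_mem_annLie φ eQ aF q hX hX'
  have hmem : ∀ X ∈ 𝔞, (∀ i, X * aF i = aF i * X) ∧ ∀ v w, φ (X v) w + φ v (X w) = 0 :=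
    fun X hX => ((mem_annLie_iff φ eQ aF q X).1 hX).2
  have hP₁ : ∀ X ∈ 𝔞, X * (ι₁ ∘ₗ π₁) = (ι₁ ∘ₗ π₁) * X := fun X hX => (hmem X hX).1 (Sum.inr (Sum.inl ()))
  have hP₂ : ∀ X ∈ 𝔞, X * (ι₂ ∘ₗ π₂) = (ι₂ ∘ₗ π₂) * X := fun X hX => (hmem X hX).1 (Sum.inr (Sum.inr ()))
  have hc₁skew : ∀ X ∈ 𝔞, ∀ v w, ψ₁.form ((π₁ ∘ₗ X ∘ₗ ι₁) v) w + ψ₁.form v ((π₁ ∘ₗ X ∘ₗ ι₁) w) = 0 := by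
    intro X hX v w
    have h := (hmem X hX).2 (ι₁ v) (ι₁ w)
    rw [apply_incl_eq_of_commute_projector hπι₁ (hP₁ X hX) v,
      apply_incl_eq_of_commute_projector hπι₁ (hP₁ X hX) w, hφapply, hφapply] at h
    simp only [e11, e21, map_zero, add_zero] at h
    simpa only [LinearMap.comp_apply] using h
  -- (HOM) in the `Θ`-form and the Goursat step
  have hHom' : ∀ f : V₂ →ₗ[ℚ] V₁, Θ₁ ∘ₗ f.baseChange ℂ = f.baseChange ℂ ∘ₗ Θ₂ → f = 0 := fun f hf =>
    eq_zero_of_theta_comp_eq_of_hom_eq_zero hn H₁ H₂ heff₁ heff₂ hΘ₁ hΘ₂ hHom hf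
  have h2 := goursat_incl₂_mem_of_hom_eq_zero_of_rigidBlocks hn H₁ H₂ heff₁ heff₂ hπι₁ hπι₂ hπ₁ι₂ hπ₂ι₁ hsum 𝔞
    hbr𝔞 hP₁ hP₂ ψ₁ ψ₂ hc₁skew hΘ₁ hΘ₂ hself₂ τ hint hrigid hΘ𝔞 hΘι₁ hΘι₂ hHom'
  exact ⟨h2, hΘ𝔞⟩

/-- **`0 ⊕ (hg(V₂) ⊗ ℂ) ⊆ 𝔞(q)_ℂ`**: with the hypotheses of the core theorem, `ι₂ ∘ Y ∘ π₂ ∈ 𝔞(q)_ℂ` for EVERY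
`Y ∈ Lie Hg(H₂) ⊗ ℂ = ⊕ᵢ 𝔰𝔭(Tᵢ)` («`Hg(X₁ × X₂) ⊇ 1 × Hg(X₂)`» read on tensors).
[cite: MoonenZarhin1999LowDim, §3 (3.1), Thm. (3.2)(1) and Lemma (3.4)] [cite: Hazama1989, Thm. (= Gordon 7.6.2)]
[cite: Deligne1982HodgeCycles, I §3 (proof of Prop. 3.4)] -/
theorem incl₂_comp_proj_mem_spanC_annLie_of_times_rigidBlocks (hn : n = 1) (HU : HodgeStructure U n)
    (H₁ : HodgeStructure V₁ n) (H₂ : HodgeStructure V₂ n) (heff₁ : H₁.IsEffective) (heff₂ : H₂.IsEffective)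
    {ι₁ : V₁ →ₗ[ℚ] U} {π₁ : U →ₗ[ℚ] V₁} {ι₂ : V₂ →ₗ[ℚ] U} {π₂ : U →ₗ[ℚ] V₂}
    (hπι₁ : π₁ ∘ₗ ι₁ = LinearMap.id) (hπι₂ : π₂ ∘ₗ ι₂ = LinearMap.id) (hπ₁ι₂ : π₁ ∘ₗ ι₂ = 0)
    (hπ₂ι₁ : π₂ ∘ₗ ι₁ = 0) (hsum : ι₁ ∘ₗ π₁ + ι₂ ∘ₗ π₂ = LinearMap.id)
    (hι₁F : ∀ p, ∀ x ∈ H₁.piece p (n - p), ι₁.baseChange ℂ x ∈ HU.piece p (n - p))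
    (hι₂F : ∀ p, ∀ x ∈ H₂.piece p (n - p), ι₂.baseChange ℂ x ∈ HU.piece p (n - p))
    (ψ₁ : H₁.Polarization) (ψ₂ : H₂.Polarization)
    (hself₂ : ∀ a : H₂.endAlg, LinearMap.IsAdjointPair ψ₂.form ψ₂.form (a : Module.End ℚ V₂) (a : Module.End ℚ V₂))
    (τ : κ → (H₂.endAlg →+* ℂ)) (hint : DirectSum.IsInternal fun k => H₂.eigenBlock (τ k))
    (hrigid : ∀ Y : Module.End ℂ (ℂ ⊗[ℚ] V₂), (∀ k, Set.MapsTo Y (H₂.eigenBlock (τ k)) (H₂.eigenBlock (τ k))) →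
      (∀ x y, ψ₂.form.baseChange ℂ (Y x) y + ψ₂.form.baseChange ℂ x (Y y) = 0) → Y ∈ H₂.hodgeLieC)
    (hHom : ∀ f : V₂ →ₗ[ℚ] V₁,
      (∀ p, ∀ x ∈ H₂.piece p (n - p), f.baseChange ℂ x ∈ H₁.piece p (n - p)) → f = 0)
    (eQ : Module.Basis (Fin M) ℚ U) (q : (Fin d → Fin m × Fin M) → ℚ)
    {ΘU : Module.End ℂ (ℂ ⊗[ℚ] U)} (hΘU : ∀ p, ∀ x ∈ HU.piece p (n - p), ΘU x = ((2 * p - n : ℤ) : ℂ) • x)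
    (hΘq : ∀ u : Fin d → Fin m, wordDerAt ℂ (fun _ : Fin d =>
      LinearMap.toMatrix (Algebra.TensorProduct.basis ℂ eQ) (Algebra.TensorProduct.basis ℂ eQ) ΘU)
      (wordSlice (fun w => algebraMap ℚ ℂ (q w)) u) = 0)
    {Y : Module.End ℂ (ℂ ⊗[ℚ] V₂)} (hY : Y ∈ H₂.hodgeLieC) :
    ι₂.baseChange ℂ ∘ₗ Y ∘ₗ π₂.baseChange ℂ ∈ spanC (annLie (ψ₁.form.compl₁₂ π₁ π₁ + ψ₂.form.compl₁₂ π₂ π₂) eQ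
        (Sum.elim (fun a : H₁.endAlg => ι₁ ∘ₗ (a : Module.End ℚ V₁) ∘ₗ π₁)
          (Sum.elim (fun _ : Unit => ι₁ ∘ₗ π₁) (fun _ : Unit => ι₂ ∘ₗ π₂))) q) := by
  classical
  obtain ⟨h2, -⟩ := incl₂_mem_annLie_of_times_rigidBlocks hn HU H₁ H₂ heff₁ heff₂ hπι₁ hπι₂ hπ₁ι₂ hπ₂ι₁ hsum hι₁F
    hι₂F ψ₁ ψ₂ hself₂ τ hint hrigid hHom eQ q hΘU hΘq
  rw [hodgeLieC_eq_spanC] at hY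
  induction hY using Submodule.span_induction with
  | mem Y₁ hY₁ =>
    obtain ⟨X, hX, rfl⟩ := hY₁
    rw [← LinearMap.baseChange_comp, ← LinearMap.baseChange_comp]
    exact baseChange_mem_spanC (h2 X hX)
  | zero => rw [LinearMap.zero_comp, LinearMap.comp_zero]; exact Submodule.zero_mem _
  | add Y₁ Y₂ _ _ hY₁ hY₂ => rw [LinearMap.add_comp, LinearMap.comp_add]; exact Submodule.add_mem _ hY₁ hY₂
  | smul c Y₁ _ hY₁ => rw [LinearMap.smul_comp, LinearMap.comp_smul]; exact Submodule.smul_mem _ c hY₁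

/-- **Theorem (second factor, word model): the rational `Θ_U`-killed tensor `q` on `U = H¹(X₁) ⊕ H¹(X₂)` is killed
by the matrix of `ι₂ ∘ Y ∘ π₂` for EVERY `Y ∈ Lie Hg(X₂) ⊗ ℂ`** (`X₂` with rigid symplectic blocks, `Hom(X₂, X₁) = 0`):
«`Hg(X₁ × X₂) ⊇ 1 × Hg(X₂)`» read on tensors. [cite: MoonenZarhin1999LowDim, §3 (3.1), Thm. (3.2)(1) and Lemma (3.4)]
[cite: Hazama1989, Thm. (= Gordon 7.6.2)] [cite: Deligne1982HodgeCycles, I §3 (proof of Prop. 3.4)] -/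
theorem wordDerAt_incl₂_eq_zero_of_times_rigidBlocks (hn : n = 1) (HU : HodgeStructure U n)
    (H₁ : HodgeStructure V₁ n) (H₂ : HodgeStructure V₂ n) (heff₁ : H₁.IsEffective) (heff₂ : H₂.IsEffective)
    {ι₁ : V₁ →ₗ[ℚ] U} {π₁ : U →ₗ[ℚ] V₁} {ι₂ : V₂ →ₗ[ℚ] U} {π₂ : U →ₗ[ℚ] V₂}
    (hπι₁ : π₁ ∘ₗ ι₁ = LinearMap.id) (hπι₂ : π₂ ∘ₗ ι₂ = LinearMap.id) (hπ₁ι₂ : π₁ ∘ₗ ι₂ = 0)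
    (hπ₂ι₁ : π₂ ∘ₗ ι₁ = 0) (hsum : ι₁ ∘ₗ π₁ + ι₂ ∘ₗ π₂ = LinearMap.id)
    (hι₁F : ∀ p, ∀ x ∈ H₁.piece p (n - p), ι₁.baseChange ℂ x ∈ HU.piece p (n - p))
    (hι₂F : ∀ p, ∀ x ∈ H₂.piece p (n - p), ι₂.baseChange ℂ x ∈ HU.piece p (n - p))
    (ψ₁ : H₁.Polarization) (ψ₂ : H₂.Polarization)
    (hself₂ : ∀ a : H₂.endAlg, LinearMap.IsAdjointPair ψ₂.form ψ₂.form (a : Module.End ℚ V₂) (a : Module.End ℚ V₂))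
    (τ : κ → (H₂.endAlg →+* ℂ)) (hint : DirectSum.IsInternal fun k => H₂.eigenBlock (τ k))
    (hrigid : ∀ Y : Module.End ℂ (ℂ ⊗[ℚ] V₂), (∀ k, Set.MapsTo Y (H₂.eigenBlock (τ k)) (H₂.eigenBlock (τ k))) →
      (∀ x y, ψ₂.form.baseChange ℂ (Y x) y + ψ₂.form.baseChange ℂ x (Y y) = 0) → Y ∈ H₂.hodgeLieC)
    (hHom : ∀ f : V₂ →ₗ[ℚ] V₁,
      (∀ p, ∀ x ∈ H₂.piece p (n - p), f.baseChange ℂ x ∈ H₁.piece p (n - p)) → f = 0)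
    (eQ : Module.Basis (Fin M) ℚ U) (q : (Fin d → Fin m × Fin M) → ℚ)
    {ΘU : Module.End ℂ (ℂ ⊗[ℚ] U)} (hΘU : ∀ p, ∀ x ∈ HU.piece p (n - p), ΘU x = ((2 * p - n : ℤ) : ℂ) • x)
    (hΘq : ∀ u : Fin d → Fin m, wordDerAt ℂ (fun _ : Fin d =>
      LinearMap.toMatrix (Algebra.TensorProduct.basis ℂ eQ) (Algebra.TensorProduct.basis ℂ eQ) ΘU)
      (wordSlice (fun w => algebraMap ℚ ℂ (q w)) u) = 0)
    {Y : Module.End ℂ (ℂ ⊗[ℚ] V₂)} (hY : Y ∈ H₂.hodgeLieC) (u : Fin d → Fin m) :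
    wordDerAt ℂ (fun _ : Fin d =>
      LinearMap.toMatrix (Algebra.TensorProduct.basis ℂ eQ) (Algebra.TensorProduct.basis ℂ eQ)
        (ι₂.baseChange ℂ ∘ₗ Y ∘ₗ π₂.baseChange ℂ))
      (wordSlice (fun w => algebraMap ℚ ℂ (q w)) u) = 0 :=
  wordDerAt_eq_zero_of_mem_spanC_annLie _ eQ _ q
    (incl₂_comp_proj_mem_spanC_annLie_of_times_rigidBlocks hn HU H₁ H₂ heff₁ heff₂ hπι₁ hπι₂ hπ₁ι₂ hπ₂ι₁ hsum hι₁F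
      hι₂F ψ₁ ψ₂ hself₂ τ hint hrigid hHom eQ q hΘU hΘq hY) u

/-- **`Θ_{X₁} ⊕ 0 ∈ 𝔞(q)_ℂ`**: with the hypotheses of the core theorem, the partial Hodge operator
`ι₁ ∘ Θ₁ ∘ π₁ = Θ_U - ι₂ ∘ Θ₂ ∘ π₂` of the first factor lies in `𝔞(q)_ℂ` («`Hg(X₁ × X₂) ⊇ Hg(X₁) × 1 ∋` the
circle `Θ_{X₁}`»). [cite: MoonenZarhin1999LowDim, §3 (3.1), Thm. (3.2)(1) and Lemma (3.4)]
[cite: Hazama1989, Thm. (= Gordon 7.6.2)] [cite: Deligne1982HodgeCycles, I §3 (proof of Prop. 3.4)] -/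
theorem incl₁_theta_proj_mem_spanC_annLie_of_times_rigidBlocks (hn : n = 1) (HU : HodgeStructure U n)
    (H₁ : HodgeStructure V₁ n) (H₂ : HodgeStructure V₂ n) (heff₁ : H₁.IsEffective) (heff₂ : H₂.IsEffective)
    {ι₁ : V₁ →ₗ[ℚ] U} {π₁ : U →ₗ[ℚ] V₁} {ι₂ : V₂ →ₗ[ℚ] U} {π₂ : U →ₗ[ℚ] V₂}
    (hπι₁ : π₁ ∘ₗ ι₁ = LinearMap.id) (hπι₂ : π₂ ∘ₗ ι₂ = LinearMap.id) (hπ₁ι₂ : π₁ ∘ₗ ι₂ = 0)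
    (hπ₂ι₁ : π₂ ∘ₗ ι₁ = 0) (hsum : ι₁ ∘ₗ π₁ + ι₂ ∘ₗ π₂ = LinearMap.id)
    (hι₁F : ∀ p, ∀ x ∈ H₁.piece p (n - p), ι₁.baseChange ℂ x ∈ HU.piece p (n - p))
    (hι₂F : ∀ p, ∀ x ∈ H₂.piece p (n - p), ι₂.baseChange ℂ x ∈ HU.piece p (n - p))
    (ψ₁ : H₁.Polarization) (ψ₂ : H₂.Polarization)
    (hself₂ : ∀ a : H₂.endAlg, LinearMap.IsAdjointPair ψ₂.form ψ₂.form (a : Module.End ℚ V₂) (a : Module.End ℚ V₂))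
    (τ : κ → (H₂.endAlg →+* ℂ)) (hint : DirectSum.IsInternal fun k => H₂.eigenBlock (τ k))
    (hrigid : ∀ Y : Module.End ℂ (ℂ ⊗[ℚ] V₂), (∀ k, Set.MapsTo Y (H₂.eigenBlock (τ k)) (H₂.eigenBlock (τ k))) →
      (∀ x y, ψ₂.form.baseChange ℂ (Y x) y + ψ₂.form.baseChange ℂ x (Y y) = 0) → Y ∈ H₂.hodgeLieC)
    (hHom : ∀ f : V₂ →ₗ[ℚ] V₁,
      (∀ p, ∀ x ∈ H₂.piece p (n - p), f.baseChange ℂ x ∈ H₁.piece p (n - p)) → f = 0)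
    (eQ : Module.Basis (Fin M) ℚ U) (q : (Fin d → Fin m × Fin M) → ℚ)
    {ΘU : Module.End ℂ (ℂ ⊗[ℚ] U)} (hΘU : ∀ p, ∀ x ∈ HU.piece p (n - p), ΘU x = ((2 * p - n : ℤ) : ℂ) • x)
    (hΘq : ∀ u : Fin d → Fin m, wordDerAt ℂ (fun _ : Fin d =>
      LinearMap.toMatrix (Algebra.TensorProduct.basis ℂ eQ) (Algebra.TensorProduct.basis ℂ eQ) ΘU)
      (wordSlice (fun w => algebraMap ℚ ℂ (q w)) u) = 0)
    {Θ₁ : Module.End ℂ (ℂ ⊗[ℚ] V₁)} (hΘ₁ : ∀ p, ∀ x ∈ H₁.piece p (n - p), Θ₁ x = ((2 * p - n : ℤ) : ℂ) • x) :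
    ι₁.baseChange ℂ ∘ₗ Θ₁ ∘ₗ π₁.baseChange ℂ ∈ spanC (annLie (ψ₁.form.compl₁₂ π₁ π₁ + ψ₂.form.compl₁₂ π₂ π₂) eQ
        (Sum.elim (fun a : H₁.endAlg => ι₁ ∘ₗ (a : Module.End ℚ V₁) ∘ₗ π₁)
          (Sum.elim (fun _ : Unit => ι₁ ∘ₗ π₁) (fun _ : Unit => ι₂ ∘ₗ π₂))) q) := by
  obtain ⟨Θ₂, hΘ₂⟩ := exists_hodgeTheta H₂
  have hΘ₂C : Θ₂ ∈ H₂.hodgeLieC := H₂.mem_hodgeLieC_of_forall_piece hΘ₂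
  have hΘ𝔞 := (incl₂_mem_annLie_of_times_rigidBlocks hn HU H₁ H₂ heff₁ heff₂ hπι₁ hπι₂ hπ₁ι₂ hπ₂ι₁ hsum hι₁F hι₂F
    ψ₁ ψ₂ hself₂ τ hint hrigid hHom eQ q hΘU hΘq).2
  have h2 := incl₂_comp_proj_mem_spanC_annLie_of_times_rigidBlocks hn HU H₁ H₂ heff₁ heff₂ hπι₁ hπι₂ hπ₁ι₂ hπ₂ι₁
    hsum hι₁F hι₂F ψ₁ ψ₂ hself₂ τ hint hrigid hHom eQ q hΘU hΘq hΘ₂C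
  have hΘι₁ := theta_incl_eq HU H₁ hι₁F hΘU hΘ₁
  have hΘι₂ := theta_incl_eq HU H₂ hι₂F hΘU hΘ₂
  have hΘUy : ∀ y, ΘU y = ι₁.baseChange ℂ (Θ₁ (π₁.baseChange ℂ y)) + ι₂.baseChange ℂ (Θ₂ (π₂.baseChange ℂ y)) := by
    intro y
    conv_lhs => rw [← incl_proj_add_baseChange hsum y]
    rw [map_add, hΘι₁, hΘι₂]
  have hdec : ι₁.baseChange ℂ ∘ₗ Θ₁ ∘ₗ π₁.baseChange ℂ = ΘU - ι₂.baseChange ℂ ∘ₗ Θ₂ ∘ₗ π₂.baseChange ℂ := by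
    apply LinearMap.ext
    intro y
    simp only [LinearMap.sub_apply, LinearMap.comp_apply, hΘUy, add_sub_cancel_right]
  rw [hdec]
  exact Submodule.sub_mem _ hΘ𝔞 h2

/-- **Theorem (first factor, word model; Moonen–Zarhin Lemma (3.4) / Hazama's theorem with a second factor whose
Hodge Lie algebra is the full block-symplectic algebra).** Let `U = ι₁V₁ ⊕ ι₂V₂` be a presentation compatible with
effective weight-one Hodge structures `H_U`, `H₁`, `H₂`, polarizations `ψ₁`, `ψ₂`; on `V₂` every Hodge endomorphism is
`ψ₂`-self-adjoint, `V₂ ⊗ ℂ = ⊕ᵢ Tᵢ` (eigenblocks of characters of `End_Hdg(V₂)`) and every block-preserving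
`ψ₂ ⊗ ℂ`-skew operator lies in `Lie Hg(H₂) ⊗ ℂ` (RIGID BLOCKS); and `Hom_Hdg(V₂, V₁) = 0`. If a RATIONAL coefficient
tensor `q` on `U` is killed, slice by slice, by the matrix of the Hodge operator `Θ_U`, then it is killed by the matrix
of the partial Hodge operator `ι₁ ∘ Θ₁ ∘ π₁` of the first factor — the conclusion of the tree's
`wordDerAt_incl_proj_theta_eq_zero_of_times_rigidSymplectic` (the case of ONE block), so the typed-Künneth pipeline of
`HodgeTheory/TimesGenericStablyNondegenerateProductSpan` applies verbatim to `X₁ × X₂`. The hypotheses on `X₁` are NONE.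
[cite: MoonenZarhin1999LowDim, §3 (3.1), Thm. (3.2)(1), Lemma (3.3), Lemma (3.4)] [cite: Hazama1989, Thm. (= Gordon 7.6.2)]
[cite: Deligne1982HodgeCycles, I §3 Prop. 3.4 and Prop. 3.6] -/
theorem wordDerAt_incl_proj_theta_eq_zero_of_times_rigidBlocks (hn : n = 1) (HU : HodgeStructure U n)
    (H₁ : HodgeStructure V₁ n) (H₂ : HodgeStructure V₂ n) (heff₁ : H₁.IsEffective) (heff₂ : H₂.IsEffective)
    {ι₁ : V₁ →ₗ[ℚ] U} {π₁ : U →ₗ[ℚ] V₁} {ι₂ : V₂ →ₗ[ℚ] U} {π₂ : U →ₗ[ℚ] V₂}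
    (hπι₁ : π₁ ∘ₗ ι₁ = LinearMap.id) (hπι₂ : π₂ ∘ₗ ι₂ = LinearMap.id) (hπ₁ι₂ : π₁ ∘ₗ ι₂ = 0)
    (hπ₂ι₁ : π₂ ∘ₗ ι₁ = 0) (hsum : ι₁ ∘ₗ π₁ + ι₂ ∘ₗ π₂ = LinearMap.id)
    (hι₁F : ∀ p, ∀ x ∈ H₁.piece p (n - p), ι₁.baseChange ℂ x ∈ HU.piece p (n - p))
    (hι₂F : ∀ p, ∀ x ∈ H₂.piece p (n - p), ι₂.baseChange ℂ x ∈ HU.piece p (n - p))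
    (ψ₁ : H₁.Polarization) (ψ₂ : H₂.Polarization)
    (hself₂ : ∀ a : H₂.endAlg, LinearMap.IsAdjointPair ψ₂.form ψ₂.form (a : Module.End ℚ V₂) (a : Module.End ℚ V₂))
    (τ : κ → (H₂.endAlg →+* ℂ)) (hint : DirectSum.IsInternal fun k => H₂.eigenBlock (τ k))
    (hrigid : ∀ Y : Module.End ℂ (ℂ ⊗[ℚ] V₂), (∀ k, Set.MapsTo Y (H₂.eigenBlock (τ k)) (H₂.eigenBlock (τ k))) →
      (∀ x y, ψ₂.form.baseChange ℂ (Y x) y + ψ₂.form.baseChange ℂ x (Y y) = 0) → Y ∈ H₂.hodgeLieC)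
    (hHom : ∀ f : V₂ →ₗ[ℚ] V₁,
      (∀ p, ∀ x ∈ H₂.piece p (n - p), f.baseChange ℂ x ∈ H₁.piece p (n - p)) → f = 0)
    (eQ : Module.Basis (Fin M) ℚ U) (q : (Fin d → Fin m × Fin M) → ℚ)
    {ΘU : Module.End ℂ (ℂ ⊗[ℚ] U)} (hΘU : ∀ p, ∀ x ∈ HU.piece p (n - p), ΘU x = ((2 * p - n : ℤ) : ℂ) • x)
    (hΘq : ∀ u : Fin d → Fin m, wordDerAt ℂ (fun _ : Fin d =>
      LinearMap.toMatrix (Algebra.TensorProduct.basis ℂ eQ) (Algebra.TensorProduct.basis ℂ eQ) ΘU)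
      (wordSlice (fun w => algebraMap ℚ ℂ (q w)) u) = 0)
    {Θ₁ : Module.End ℂ (ℂ ⊗[ℚ] V₁)} (hΘ₁ : ∀ p, ∀ x ∈ H₁.piece p (n - p), Θ₁ x = ((2 * p - n : ℤ) : ℂ) • x)
    (u : Fin d → Fin m) :
    wordDerAt ℂ (fun _ : Fin d =>
      LinearMap.toMatrix (Algebra.TensorProduct.basis ℂ eQ) (Algebra.TensorProduct.basis ℂ eQ)
        (ι₁.baseChange ℂ ∘ₗ Θ₁ ∘ₗ π₁.baseChange ℂ))
      (wordSlice (fun w => algebraMap ℚ ℂ (q w)) u) = 0 :=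
  wordDerAt_eq_zero_of_mem_spanC_annLie _ eQ _ q
    (incl₁_theta_proj_mem_spanC_annLie_of_times_rigidBlocks hn HU H₁ H₂ heff₁ heff₂ hπι₁ hπι₂ hπ₁ι₂ hπ₂ι₁ hsum hι₁F
      hι₂F ψ₁ ψ₂ hself₂ τ hint hrigid hHom eQ q hΘU hΘq hΘ₁) u

end Main

end HodgeStructure

end Literature.AlgebraicGeometry.Motives

end
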